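import Mathlib
import Literature.Geometry.Lorentzian.GiorgiKlainermanSzeftel2022.GRWTransformationAlgebra
import Literature.Geometry.Lorentzian.GiorgiKlainermanSzeftel2022.TeukolskyQfbLedger
import Literature.Geometry.Lorentzian.GiorgiKlainermanSzeftel2022.TeukolskyStarobinskiPrelimLedger

/-!
# Giorgi–Klainerman–Szeftel — App. D.8.2 ledger: the derivation of the Teukolsky–Starobinski identity (Lemmas D.8.6–D.8.9, the conclusion, the check in Kerr, the `q`-weights)

Sources, read side by side (the loci of both are given in every docstring):

* `[J]`  E. Giorgi, S. Klainerman, J. Szeftel, *Wave equations estimates and the nonlinear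
  stability of slowly rotating Kerr black holes*, Pure Appl. Math. Q. **20** (2024), no. 7
  (doi:10.4310/pamq.241128023033) — Proposition 5.4.1 (file p0204 L34–42: "Assume that `Ξ = 0` in
  `r ≤ r₀`.  The complex tensors `A, A̲ ∈ 𝔰₂(ℂ)` satisfy the following relation in the region
  `r ≤ r₀`: `(ᶜ∇₄ + 2tr X)⁴A̲ = r⁻⁴𝔡^{≤4}A + 𝔡^{≤3}(Γ_b·Γ_g)` (5.4.1)") is proved in Appendix D.8;
  the sibling module `TeukolskyStarobinskiPrelimLedger` types §D.8.1 (Definition D.8.1, Lemmas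
  D.8.2–D.8.5) and THIS module types §D.8.2 "The derivation of the Teukolsky-Starobinski identity"
  (file p0909 L5 – p0927 L60): the rescaled Bianchi identity (D.8.1) (p0909 L9–19), Lemma D.8.6
  (p0909 L21–37, proof p0909 L39 – p0910 L128), Lemma D.8.7 (p0911 L5–34, proof p0911 L36 – p0914
  L46), the splitting `ℌ = ℌ₁ + (3/2)Pℌ₂ + (3/2)P conj(tr X̲)A` with (D.8.3) (p0914 L48–105), Lemma
  D.8.8 (p0915 L5–42, proof p0915 L44 – p0917 L49), Lemma D.8.9 (p0917 L51 – p0918 L4, proof p0918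
  L5 – p0923 L10), "We can finally conclude the derivation" (p0923 L12 – p0924 L48), "We now show
  that the terms in the parenthesis vanish in Kerr" (p0924 L49 – p0925 L61), `𝒫(A)` (p0925 L62 –
  p0926 L51) and "Finally we show that `ᶜ∇₄ℌ + (7/2)tr X ℌ = (ᶜ∇₄ + 2tr X)⁴A̲`" (p0926 L52 – p0927
  L60).  "file pNNNN Lm" = page NNNN of the journal PDF (folio NNNN−1), line m of its text layer;
* `[v1]` the same authors and title, arXiv:2205.14808v1 (2022), TeX source: subsection "The
  derivation of the Teukolsky-Starobinski identity" l.36909–37545 — (Bianchi1) l.36913–36915,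
  Lemma `first-derivative` l.36925–36988, Lemma `third-derivative` l.36997–37086, the splitting and
  (nabc4mathfrakH) l.37096–37112, Lemma `nabc4mathfrak1` l.37118–37194, Lemma `nabc4mathfrak2`
  l.37200–37407, the conclusion l.37411–37446, the Kerr check l.37448–37486, `𝒫(A)` l.37489–37506,
  the `q`-weights l.37510–37545.

Also quoted, for the component check of §0bis and as the source of the hypotheses named below:
`[J]` Definition 2.1.12 (file p0069 L10–24 = `[v1]` l.2755–2770: "`ξ·η := δ^{ab}ξ_aη_b`,
`(ξ⊗̂η)_{ab} := ξ_aη_b + ξ_bη_a − δ_{ab}ξ·η`", "`(ξ·U)_a := δ^{bc}ξ_bU_{ac}`"), `[J]` Lemma 2.4.5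
(2.4.2) (file p0111 L35–37, proof p0111 L46 – p0112 L12 = `[v1]` Lemma `dot-hot-complex`
(simil-Leibniz) l.4928–4967: "`E⊗̂(F̄·U) + F⊗̂(Ē·U) = 2(E·F̄ + Ē·F)U`"), `[J]` Lemma 2.4.6 (2.4.4)
(file p0112 L16–31 = `[v1]` l.4978–4988; in particular (rule-1) "`U·conj𝒟F = U(conj𝒟·F)`").

The two texts agree on every statement and display typed here (collation in the cell's DIVERGENCE
ledger).  Slips common to both, read through: `ℬ₁` for `ℬ` in the last two displays of the proof of
Lemma D.8.7 (`[v1]` l.37067–37068, 37078–37079 = `[J]` p0913 L127–129, p0914 L11–14); in the proof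
of Lemma D.8.9 "`−6P̄Ξ`" for "`−6P̄ Ξ⊗̂H̲`" (l.37266, copied into the definition of `𝓜̃[Ξ]` l.37213 =
p0919 L18, p0917 L82), "`+ +`" (l.37372 = p0922 L22), and inside `𝓜̃[Ξ]` / `Expr₃(A)` the factor
multiplying `(𝒟⊗̂Ξ + Ξ⊗̂(H̲ + H))` resp. `A` printed with `−conj𝒟·H̲` (and, in `𝓜̃[Ξ]`, with no sign in
front of it) where the computation carries `+(conj(tr X tr X̲) − 2conj𝒟·H̲ − 2P)` (l.37216, 37379 =
p0917 L96, p0922 L39–43; the statement's `Expr₄(A)`, l.37209, prints the `2`); in the `q`-weight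
paragraph the sign of "`(1/q⁷)∇₄(q²∇₄(q²∇₄(q²ᶜ∇₄(qA̲)))) = 𝒫(A)`" (l.37527 = p0926 L98–110: with
`𝔉 = −(1/q)ᶜ∇₄(qA̲)` the left side is `−(ᶜ∇₄ℌ + (7/2)tr X ℌ)`, `qweights`), the prefactors
`1/q³, 1/q², 1/q³` of l.37531–37533 and the `1/q⁴` on the left of l.37538 (= p0927 L1–47) — all
immaterial for the schematic right-hand side of (5.4.1), whose overall sign and weight are not
asserted.

## What is transcribed

With `𝔉 := −ᶜ∇₄A̲ − ½tr X A̲`, `𝔊 := ᶜ∇₄𝔉 + (3/2)tr X 𝔉`, `ℌ := ᶜ∇₄𝔊 + (5/2)tr X 𝔊` and the cast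
`𝒜₁, …, 𝒜₄, ℬ` of Definition D.8.1, "modulo quadratic terms":
* D.8.6: `ᶜ∇₄𝔉 + (3/2)tr X 𝔉 = −𝒟⊗̂𝒜₁ − 5H̲⊗̂𝒜₁ − 2tr X H̲⊗̂B̲ − (3/2)P(tr X X̲̂ + conj(tr X̲)X̂ − 2𝒜₂)`
  (§1 `D86`);
* D.8.7: `ᶜ∇₄𝔊 + (5/2)tr X 𝔊 = −½𝒟⊗̂𝒟ℬ − 5H̲⊗̂𝒟ℬ − 10(H̲⊗̂H̲)ℬ + 3tr X H̲⊗̂𝒜₁ + (3/2)P conj(tr X̲)A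
  + (3/2)P[𝒜₄ − 2B⊗̂H̲ − 𝒟⊗̂(H̄·X̂) + (conj(tr X tr X̲) − 2conj𝒟·H̲ − 2P)X̂ − 3H̲⊗̂(H̄·X̂)]`
  (§2 `D87_raw`, `D87_final`; with D.8.2 / D.8.3 by name: `D87_raw_of_D82`, `D87_final_of_D83`), the
  splitting `ℌ = ℌ₁ + (3/2)Pℌ₂ + (3/2)P conj(tr X̲)A` and (D.8.3) `ᶜ∇₄ℌ = ᶜ∇₄ℌ₁ + (3/2)P[ᶜ∇₄ℌ₂ −
  (3/2)tr X ℌ₂] + ᶜ∇₄((3/2)P conj(tr X̲)A)` (`nab4_frakH`);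
* D.8.8: `ᶜ∇₄ℌ₁ + (7/2)tr X ℌ₁ = (3/2)P[−𝒟⊗̂(𝒟𝒟·Ξ̄) − 6H̲⊗̂𝒟𝒟·Ξ̄ − 6(H̲⊗̂H̲)𝒟·Ξ̄
  − 3tr X conj(tr X̲)H̲⊗̂Ξ + 3tr X H̲⊗̂(H̄·X̂) + 3tr X H̲⊗̂𝒜₃] + Expr₂(A)` (§2b: the four displayed
  steps `D88_expand`, `D88_reorganize`, `D88_line2`, `D88_final_of` and the assembly `D88`; with D.8.5 /
  D.8.2 by name: `D88_expand_of_D85`);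
* D.8.9: `ᶜ∇₄ℌ₂ = −2tr X ℌ₂ − 3tr X H̲⊗̂𝒜₃ + 𝓜̃[Ξ] + [½(3tr X − 3conj tr X)conj(tr X tr X̲)
  + 3conj(tr X)conj𝒟·H̲ − 3tr X(H̲·H̲̄) − 3tr X H̄·H̲ + 3(conj(tr X)P − tr X P̄)]X̂ + Expr₄(A)` (§3:
  `D89_split`, the five terms `D89_I1` … `D89_I5` with `D89_Z3`, the sum `D89_sum`, the `B`-terms
  `D89_final`, and the assembly `D89`; with D.8.4 by name: `D89_I1_of_D84`; `𝓜̃[Ξ]`, `Expr₃`, `Expr₄` —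
  schematic in print — are the EXPLICIT sums of the kernel);
* the conclusion `ᶜ∇₄ℌ + (7/2)tr X ℌ = (3/2)P[T]X̂ + Expr₂(A) + (3/2)P Expr₄(A) + ᶜ∇₄((3/2)P conj(tr
  X̲)A) + (21/4)P tr X conj(tr X̲)A` with `T = ½(3tr X − 3conj tr X)conj(tr X tr X̲) + 3conj(tr
  X)conj𝒟·H̲ − 3tr X(H̲·H̲̄) + 3(conj(tr X)P − tr X P̄)` (§4 `TS_conclusion`, `TS_Xh_coefficient`);
* "the terms in the parenthesis vanish in Kerr": `T = 0` on the displayed Kerr values (§5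
  `kerr_pairings`, `kerr_T1_zero`, `kerr_T_residual`);
* "`ᶜ∇₄ℌ + (7/2)tr X ℌ = (ᶜ∇₄ + 2tr X)⁴A̲`": the `q`-weight identities `𝔉 = −(1/q)ᶜ∇₄(qA̲)`, `𝔊 =
  (1/q³)∇₄(q³𝔉)`, `ℌ = (1/q⁵)∇₄(q⁵𝔊)`, `∇₄ℌ + (7/2)tr X ℌ = (1/q⁷)∇₄(q⁷ℌ)`, the expansion
  `q⁴∇₄⁴A̲ + 16q³∇₄³A̲ + 72q²∇₄²A̲ + 96q∇₄A̲ + 24A̲` and `(1/q⁴)ᶜ∇₄⁴(q⁴A̲) = (∇₄ + 2tr X)⁴A̲` (§6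
  `D4_qpow`, `qweights`, `qweights_expand`);
* §0bis `simil_leibniz_components`: the component computation behind `[J]` (2.4.2)/(2.4.3) from
  Definition 2.1.12 (see PRINT DATUM below).

## How it is typed (the model and its limits)

The scalar–module shadow of the sibling module, whose header describes it in full, whose numeral
helper `Dm_num` is used by name, and whose certified statements of Lemmas D.8.2–D.8.5 ENTER BY NAME
where §D.8.2 invokes them: `D87_raw_of_D82` (`D82_nab4_A1`, `D82_nab4_Dhat_A1`,
`D82_nab4_Dhat_A1_printed`), `D87_final_of_D83` (`D83`), `D88_expand_of_D85` (`D85_nab4_B`,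
`D85_nab4_DB`, `D85_nab4_DhatDB`, `D82_nab4_A1`), `D89_I1_of_D84` (`D84_final`) — each discharges the
corresponding "in the shape of" hypothesis of the display-level theorem from the sibling's
hypotheses verbatim, so the brackets of dropped products and the collapse parameter `c` propagate
from the kernel-certified §D.8.1 into §D.8.2 (in particular the hypothesis `hI1` of `D89_I1` / `D89`
is discharged verbatim by `D84_final`, as `D89_I1_of_D84` exhibits, so the `c` reaching
`TS_conclusion` through `h89` is the `c` of `D84_final`'s `hcol1`, `hcol2`): scalars in a field
`K` of characteristic zero (`x = tr X`, `xc = conj tr X`, `xb = tr X̲`, `xbc = conj tr X̲`, `p = P`,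
`pc = P̄`, `bb = ℬ`, `HbBc = H̲·B̄`,
`d = 𝒟·Ξ̄`, `W' = (𝒟 + 3H̲)·(𝒟·Ā + Ā·H̲)`, and the pairings the text keeps whole: `hh = H̲·H̲̄ = H̲̄·H̲`,
`HHc = H·H̄`, `HbHc = H̲·H̄ = H̄·H̲`, `HbcH = H̲̄·H`, `DbHb = conj𝒟·H̲`); one-forms in a `K`-module `M₁`
(`Hb = H̲`, `H`, `Hc = H̄`, `Hbc = H̲̄`, `Xi = Ξ`, `B`, `Bb = B̲`, `A1 = 𝒜₁`, `A3 = 𝒜₃`, `U = H̄·X̂`, `Ub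
= H̲̄·X̂`, `E' = (𝒟 + H̲)(W')`, …), symmetric traceless two-tensors in `M₂` (`Ab = A̲`, `A`, `Xh = X̂`,
`Xbh = X̲̂`, `A2`, `A4`, `Ff = 𝔉`, `Gg = 𝔊`, `Hh = ℌ`, `H1 = ℌ₁`, `H2 = ℌ₂`, …).  `ᶜ∇₄` is `D4 :
Derivation ℤ K K` on scalars and a `CovD D4` on `M₁`/`M₂` (additive + Leibniz, the only properties
the displays use); `𝒟` on scalars is `Dc : Derivation ℤ K M₁`; `𝒟⊗̂` an additive `Dhat` with the
Leibniz rule `hDL` (`[J]` (2.4.4)); `⊗̂` a bilinear `hot`; `F ↦ H̄·F` a bilinear `dotT` where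
`ᶜ∇₄(H̄·X̂)` is expanded (`D89_Z3`); `F ↦ X̂·conj𝒟F` and `ᶜ∇₃` (never expanded) additive maps `XDb`,
`n3`.  Silent uses of the symmetry of `⊗̂` are named hypotheses `hs…`.  In §5 the Kerr values are
field elements: `q`, `qb = q̄`, `n = |q|² = qq̄`, `r = (q + q̄)/2`, `a²cos²θ = −(q − q̄)²/4`,
`a²sin²θ = a² − a²cos²θ`, `Δ = r² − 2mr + a²`, and "`i·2a cos θ`" is `q − q̄`.

CONVENTION FOR "MODULO QUADRATIC TERMS" — the sibling module's, verbatim: every quoted identity enters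
EXACTLY AS THE PROOF DISPLAYS IT, as a hypothesis on operator values (the commutators of `[J]` Lemma
4.2.2 in the displayed instances — (4.2.13) `F = B̲, s = −1` and `F = H̄·X̂, s = 1` in the err form,
(4.2.16) `F = H̲, s = 0` —, the Bianchi identities (D.8.1), (D.8.2) and those for `ᶜ∇₄B`, `−tr X 𝒟⊗̂B −
4tr X B⊗̂H`, the Ricci identities for `ᶜ∇₄X̂`, `ᶜ∇₄X̲̂`, Lemmas D.8.2–D.8.5 in the shape of the sibling
module's conclusions); every BACKGROUND "`+ O(ε)`" substitution made inside a product (`ᶜ∇₄P =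
−(3/2)tr X P`, `ᶜ∇₄tr X = −½(tr X)²`, `ᶜ∇₄conj tr X = −½(conj tr X)²`, `ᶜ∇₄H̲ = −tr X H̲`, `ᶜ∇₄H̄ =
−½tr X(H̄ − H̲̄)`, `𝒟P = −3PH̲`, `𝒟tr X = −2tr X H̲`, `𝒟conj tr X = (tr X − conj tr X)H`, `𝒟conj(tr X̲) =
(tr X̲ − conj tr X̲)H̲`, `conj𝒟(tr X)·H̲ = (conj tr X − tr X)H̄·H̲`, `conj(tr X)H̄ = −tr X H̲̄`, `conj(tr
X)H̲ = −tr X H`, `𝒟⊗̂H̲ = −H̲⊗̂H̲ + 𝒜₂`, `(𝒟H̲)·B̄ = −H̲(H̲·B̄)`, `ᶜ∇₄conj(tr X̲) = −½conj(tr X tr X̲) +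
conj𝒟·H̲ + H̲·H̲̄ + 2P`, `H̲̄·ᶜ∇₄H̲ = −tr X H̲·H̲̄`, `conj𝒟·ᶜ∇₄H̲ = −conj𝒟·(tr X H̲)`) enters with an
OPAQUE first-order remainder (`e4P`, `e4x`, `g4`, `gx`, `gP`, `r1`, …), so that nothing defined to
be `O(ε)` is forced to vanish; each conclusion is the PRINTED right-hand side `+` an explicit last
bracket collecting the dropped products — the kernel exhibits what "modulo quadratic terms" stands
for at every display.

## Certified here (32 theorems, 0 `sorry`, 0 new definitions)

Every displayed equality of `[J]` pp. 908–926 (`[v1]` l.36909–37545) is an identity of the model with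
the coefficients AS PRINTED — given the inputs as printed —, with the parametrised exception below and
the sign of l.37527 noted above.

PRINT DATUM (PD-c), DECIDED IN THE KERNEL RELATIVE TO THE INPUTS AS PRINTED (a localisation offered to
the census, not a ruling on (5.4.1)).  The sibling module records that the proof of Lemma D.8.4
collapses `E⊗̂(F̄·X̂)` to `c(E·F̄)X̂` with `c = 1` where `[J]` Lemma 2.4.5 (2.4.2)/(2.4.3), as printed
and proved, give the factor `2`.  §D.8.2 collapses three more times with factor 1 — proof of D.8.9,
`I₃`: "`½𝒟(conj tr X)⊗̂(H̄·X̂) = ½(tr X − conj tr X)(H·H̄)X̂`" (l.37305–37312 = p0920 L50–72), `I₅`: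
"`(3/2)tr X H̲⊗̂((H̄ − H̲̄)·X̂) = … − (3/2)tr X(H̲·H̲̄)X̂`" (l.37359–37363 = p0921 L48 – p0922 L4), the
conclusion: "`3conj(tr X)H̲⊗̂(H̲̄·X̂) + (… − 3conj(tr X)H̲̄·H̲)X̂`" (l.37437–37438 = p0924 L20–26) — and
quotes the sum form once with factor 1: "Using (2.4.2), i.e. `H̲⊗̂(H̄·X̂) + H⊗̂(H̲̄·X̂) = (H̲·H̄ +
H̲̄·H)X̂`" (l.37434 = p0924 L10).  The kernel carries BOTH factors as free scalars — `c` on every single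
collapse (`hcol…`, and inside the printed statement of D.8.4, `h84`, exactly as the sibling's
`D84_final` concludes it) and `κ` on the sum form (`hSL`) — through D.8.9 and the conclusion, every
other input as printed, and proves:
* `TS_conclusion` + `TS_Xh_coefficient`: the coefficient of `(3/2)P·X̂` in `ᶜ∇₄ℌ + (7/2)tr X ℌ` is
  `T(c, κ) = T₁ + (1 − c)tr X(H̲·H̲̄) + 3(c − κ)conj(tr X)(H̲·H̲̄) + 3(κ − 1)tr X(H̲·H̄)`, `T₁` = the
  PRINTED parenthesis (l.37443–37444, 37450);
* `kerr_T1_zero`: the displayed Kerr computation `T₁ = 0` (l.37453–37485 = p0924 L53 – p0925 L61) is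
  REPRODUCED from the displayed Kerr values of `tr X, conj tr X̲, P, conj𝒟·H̲, H̲·H̲̄`, every
  intermediate value as printed;
* `kerr_T_residual`: on the same values (`H̲·H̄ = −2a²sin²θ q̄²/|q|⁶` from the displayed components,
  `kerr_pairings`) `T(c, κ) − T₁ = (4a²sin²θ/(q³q̄³))·((1 − c)q̄ + 3(c − κ)q − 3(κ − 1)q̄²/q)`: the
  monomials `q̄, q, q̄²/q` being independent, the linear-`X̂` terms cancel in Kerr iff `c = κ = 1`,
  the factors the appendix writes;
* `simil_leibniz_components`: from the components of Definition 2.1.12, for `E ∈ 𝔰₁(ℂ)` (`E₂ =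
  −iE₁`), `G = F̄` with `F ∈ 𝔰₁(ℂ)` (`G₂ = iG₁`) and `U ∈ 𝔰₂(ℂ)` (`U₁₂ = −iU₁₁`, `U₂₂ = −U₁₁`):
  `(E⊗̂(G·U))_{ab} = 2(E·G)U_{ab}` — each collapse separately carries the factor 2 of (2.4.2)/(2.4.3)
  —, so the book's definitions give `c = κ = 2`, for which the residual is `tr X(3H̲·H̄ − H̲·H̲̄)`, in
  Kerr `−4a²sin²θ(q + 3q̄)/(q⁴q̄²) ≠ 0` for `a sin θ ≠ 0` (times `(3/2)P = −3m/q³`: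
  `+12ma²sin²θ(q + 3q̄)/(q⁷q̄²)·X̂`).
WHAT THIS SAYS: the displayed cancellation in Kerr holds exactly when the four collapses of App. D.8
are read with the factor 1 the appendix writes, and fails by the stated amount when they are read
with the factor 2 that (2.4.2) proves from Definition 2.1.12; the text itself requires the
cancellation ("We now show that the terms in the parenthesis vanish in Kerr"), an undifferentiated
`X̂ ∈ Γ_g` with an `O(1)` coefficient being neither `r⁻⁴𝔡^{≤4}A` nor quadratic.  WHAT IT DOES NOT SAY:
which printed token is the slip.  The inputs that generate the `H̄·X̂`, `H̲̄·X̂` terms upstream (the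
`s = 1` instances of (4.2.12)/(4.2.13), the value of `ᶜ∇₄H̄`, Lemma D.8.4, the first identity of
D.8.2) enter AS PRINTED and are under the same census; a compensating factor in any of them moves the
datum.  Classification and numbering are the lead's.

READING NOTES (no effect on any display): (1) `conj(tr X tr X̲)` is carried as the product `xc·xbc`
of `conj tr X` and `conj tr X̲` (the kernel has no conjugation; only multiplicativity is used, as in
the text's own Kerr evaluation l.37460); (2) the one-form pairings are symmetric in the text's use
(`−3tr X H̄·H̲ + 3tr X H̲·H̄ = 0` between l.37437 and l.37443), so `H̲·H̄` and `H̄·H̲` are ONE symbol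
`HbHc`; (3) the text concludes "in a gauge where `Ξ = 0`" (l.37411); the kernel keeps the `Ξ`-terms
as two opaque symbols, `M8` (the `Ξ̄`/`Ξ` part of the bracket of D.8.8) and `MXt = 𝓜̃[Ξ]`, and
`TS_conclusion` carries `(3/2)P(M8 + MXt)`, which is what the gauge choice deletes; (4) the
normalisation "ω = O(ε), hence `tr X = 2/q`" (l.37521 = `[J]` Remark 5.4.3, p0204 L47) enters §6
exactly, as `ᶜ∇₄q = 1` and `tr X·q = 2` (`hDq`, `hxq`) — they only rescale opaque unknowns;
(5) in `I₂` the Bianchi identity for `ᶜ∇₄B` enters as displayed with `WA := conj𝒟·A + A·H̲̄` whole, and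
in the `B`-terms step (l.37391–37395) the displayed "`−tr X 𝒟⊗̂B − 4tr X B⊗̂H = tr X(−ᶜ∇₃A − ½tr X̲ A
− 3P̄X̂)`" is ONE hypothesis (`hBianchiA`); (6) `Expr₂(A)` enters D.8.8 as the hypothesis `hE2` on the
symbol `E2` with `W'`, `E' = (𝒟 + H̲)(W')` opaque, and is displayed, not recomputed, in the conclusion;
(7) in `𝓜̃[Ξ]` (l.37213–37215) the text expands `𝒟⊗̂(H̄·𝒟⊗̂Ξ)`, `𝒟⊗̂(H̄·(Ξ⊗̂(H̲+H)))` by (Leibniz-hot)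
without its factors 2; the kernel keeps `𝒟⊗̂(H̄·(𝒟⊗̂Ξ + Ξ⊗̂(H̲ + H)))` whole (`Dhat HcRX`), which
changes nothing outside `𝓜̃[Ξ]`.

## Not claimed

Nothing here is analysis or geometry: `K`, `M₁`, `M₂` are abstract, the operators are abstract
additive/derivation data constrained only by the displayed identities; `Γ_g`, `Γ_b`, `O(ε)`,
`r⁻ᵏ𝔡^{≤j}` and every absorption into them are outside the model and appear only as the text's
words; Lemma 4.2.2, Lemmas 2.4.5/2.4.6, the Bianchi, null-structure and Ricci identities, Lemmas
D.8.2–D.8.5 and the Kerr values of `tr X, tr X̲, P, H, H̲, conj𝒟·H̲, H̲·H̲̄` are HYPOTHESES in the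
displayed instances, not theorems; the component check of §0bis takes the type relations `E₂ = −iE₁`,
`U₁₂ = −iU₁₁`, `U₂₂ = −U₁₁` as hypotheses.  Proposition 5.4.1 is not claimed, nor its failure: the
print datum above is a statement about the displayed derivation with its inputs as printed.  Nothing
here is a hypothesis-fact of `[J]`; no `def … : Prop`.  This module is a typed reading aid for the
cell's census of `[J]` ch. 5 / App. D, not progress on any summit.
-/

namespace Literature.Geometry.Lorentzian.GiorgiKlainermanSzeftel2022.TeukolskyStarobinskiDerivLedger

open Literature.Geometry.Lorentzian.GiorgiKlainermanSzeftel2022.GRWTransformationAlgebra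
open Literature.Geometry.Lorentzian.GiorgiKlainermanSzeftel2022.TeukolskyStarobinskiPrelimLedger
  (Dm_num D82_nab4_A1 D82_nab4_Dhat_A1 D82_nab4_Dhat_A1_printed D83 D84_final D85_nab4_B D85_nab4_DB
    D85_nab4_DhatDB)

variable {K : Type*} [Field K]
variable {M₁ M₂ : Type*} [AddCommGroup M₁] [Module K M₁] [AddCommGroup M₂] [Module K M₂]

/-! ## §1 Lemma D.8.6 (`[v1]` Lemma `lemma:first-derivative`) -/

/-- Lemma D.8.6 (`[J]` p0909 L21–37, proof p0909 L39 – p0910 L128 = `[v1]` Lemma `first-derivative`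
l.36925–36988): "The quantity `𝔉 := −ᶜ∇₄A̲ − ½tr X A̲ ∈ 𝔰₂(ℂ)` satisfies, modulo quadratic terms,
`ᶜ∇₄𝔉 + (3/2)tr X 𝔉 = −𝒟⊗̂𝒜₁ − 5H̲⊗̂𝒜₁ − 2tr X H̲⊗̂B̲ − (3/2)P(tr X X̲̂ + conj(tr X̲)X̂ − 2𝒜₂)`."
Entering, as displayed: the definition of `𝔉` (`hF`); (D.8.1) = (Bianchi1) "`ᶜ∇₄A̲ + ½tr X A̲ =
−𝒟⊗̂B̲ − 4H̲⊗̂B̲ − 3PX̲̂`" (`hBianchi1`, p0909 L9–19 = l.36913–36915); the product rule for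
`ᶜ∇₄(H̲⊗̂B̲)` (`hprod`); "Lemma 4.2.2, (4.2.13), to `F = B̲` and `s = −1`" in the err form: `ᶜ∇₄𝒟⊗̂B̲ =
𝒟⊗̂ᶜ∇₄B̲ − ½tr X(𝒟⊗̂B̲ + 2H̲⊗̂B̲) + H̲⊗̂ᶜ∇₄B̲ + g₄` (`hcomm`, p0909 L63 = l.36940–36947); the Bianchi
identity (D.8.2) "`ᶜ∇₄B̲ = −tr X B̲ − (𝒟P + 3PH̲) = −tr X B̲ − 𝒜₁`" (`hBb`, l.36948–36951); the Ricci
identity "`ᶜ∇₄X̲̂ + ½tr X X̲̂ = 𝒟⊗̂H̲ + H̲⊗̂H̲ − ½conj(tr X̲)X̂ = 𝒜₂ − ½conj(tr X̲)X̂`" (`hRic`,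
l.36974–36977); `𝒟tr X =: F` (`hFx`); and the backgrounds "`ᶜ∇₄P = −(3/2)tr X P + O(ε)`" (`h4P`,
remainder `e4P`, l.36969), "`4ᶜ∇₄H̲ − 𝒟tr X = 4(−tr X H̲) − (−2tr X H̲) + O(ε)`" (`h4Hb`, `hFv`,
remainders `g4`, `gx`, l.36983–36985).  Conclusion: the printed statement `+` the bracket of dropped
products `3e4P·X̲̂ + (4g4 − gx)⊗̂B̲ + g₄`.
[cite: GiorgiKlainermanSzeftel2024, p0909 L9 – p0910 L128; GiorgiKlainermanSzeftel2022, l.36913–36988] -/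
theorem D86 [CharZero K] {D4 : Derivation ℤ K K} (N4 : CovD D4 M₁) (N4' : CovD D4 M₂)
    (Dc : Derivation ℤ K M₁) (hot : M₁ →ₗ[K] M₁ →ₗ[K] M₂) (Dhat : M₁ →+ M₂)
    (x xbc p e4P : K) (Hb Bb A1 F g4 gx : M₁) (Ab Ff Xbh Xh A2 g₄ : M₂)
    (hDL : ∀ (f : K) (u : M₁), Dhat (f • u) = f • Dhat u + hot (Dc f) u)
    (hF : Ff = -(N4'.op Ab) - (1 / 2 * x) • Ab)
    (hBianchi1 : N4'.op Ab + (1 / 2 * x) • Ab = -(Dhat Bb) - (4 : K) • hot Hb Bb - (3 * p) • Xbh)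
    (hprod : N4'.op (hot Hb Bb) = hot (N4.op Hb) Bb + hot Hb (N4.op Bb))
    (hcomm : N4'.op (Dhat Bb) = Dhat (N4.op Bb) - (1 / 2 * x) • (Dhat Bb + (2 : K) • hot Hb Bb)
      + hot Hb (N4.op Bb) + g₄)
    (hBb : N4.op Bb = -(x • Bb) - A1)
    (h4P : D4 p = -(3 / 2) * (x * p) + e4P)
    (hRic : N4'.op Xbh + (1 / 2 * x) • Xbh = A2 - (1 / 2 * xbc) • Xh)
    (hFx : Dc x = F) (h4Hb : N4.op Hb = -(x • Hb) + g4) (hFv : F = -((2 * x) • Hb) + gx) :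
    N4'.op Ff + (3 / 2 * x) • Ff = -(Dhat A1) - (5 : K) • hot Hb A1 - (2 * x) • hot Hb Bb
      - (3 / 2 * p) • (x • Xbh + xbc • Xh - (2 : K) • A2)
      + ((3 * e4P) • Xbh + hot ((4 : K) • g4 - gx) Bb + g₄) := by
  obtain ⟨-, h3, h4, -, -, -, -⟩ := Dm_num D4
  have hFf : Ff = Dhat Bb + (4 : K) • hot Hb Bb + (3 * p) • Xbh := by
    rw [hF]; linear_combination (norm := module) (-1 : K) • hBianchi1
  have hRic' : N4'.op Xbh = -((1 / 2 * x) • Xbh) + A2 - (1 / 2 * xbc) • Xh := by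
    linear_combination (norm := module) hRic
  rw [hFf, map_add, map_add, N4'.leibniz, N4'.leibniz, hcomm, hprod, hBb, hRic', h4Hb]
  subst hFv
  simp only [map_add, map_sub, map_neg, map_smul, hDL, hFx, D4.leibniz, h3, h4, h4P,
    LinearMap.add_apply, LinearMap.sub_apply, LinearMap.smul_apply, LinearMap.neg_apply,
    smul_eq_mul, mul_zero, zero_smul, add_zero, zero_add, smul_add, smul_sub, smul_neg]
  module


/-! ## §2 Lemma D.8.7 (`[v1]` Lemma `lemma:third-derivative`) and the split of `ℌ` -/

/-- Lemma D.8.7, first half of the proof (`[J]` p0911 L36 – p0913 L4 = `[v1]` l.37004–37041).  Entering: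
"We infer from Lemma D.8.6 that `𝔊 = −𝒟⊗̂𝒜₁ − 5H̲⊗̂𝒜₁ − 2tr X H̲⊗̂B̲ − (3/2)P(tr X X̲̂ + conj(tr X̲)X̂ −
2𝒜₂)`" (`hG`, with `W := tr X X̲̂ + conj(tr X̲)X̂ − 2𝒜₂` whole and the bracket `QF` of `D86` carried);
the product rules (`hP1`, `hP2`); "Using that `ᶜ∇₄P = −(3/2)tr X P + O(ε)`, `ᶜ∇₄tr X = −½(tr X)² +
O(ε)`, `ᶜ∇₄H̲ = −tr X H̲ + O(ε)` and `ᶜ∇₄B̲ = −tr X B̲ − 𝒜₁`" (`h4P`, `h4x`, `h4Hb` with remainders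
`e4P`, `e4x`, `g4`; `hBb`; l.37014); "Using Lemma D.8.2 for the derivatives of `𝒜₁`" — both
identities in their printed form, i.e. in the shape of the sibling module's `D82_nab4_A1` and
`D82_nab4_Dhat_A1_printed` (`h82a`, `h82b`; `T := (3/2)P(H̄·X̂ − conj(tr X̲)Ξ + 𝒜₃)` whole,
remainders `Q1`, `Q2`; p0912 L2 = l.37019).  Conclusion: the display after "Writing `𝒟⊗̂𝒜₁ + 2tr X
H̲⊗̂B̲ = −𝔊 − 5H̲⊗̂𝒜₁ − (3/2)P(tr X X̲̂ + conj(tr X̲)X̂ − 2𝒜₂)`, we obtain" (l.37032–37041 = p0912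
L110 – p0913 L4): `ᶜ∇₄𝔊 + (5/2)tr X 𝔊 = −½𝒟⊗̂𝒟ℬ − 5H̲⊗̂𝒟ℬ − 10(H̲⊗̂H̲)ℬ + 3tr X H̲⊗̂𝒜₁ − 𝒟⊗̂(T) −
6H̲⊗̂(T) − (3/2)P[ᶜ∇₄W + tr X W]` (the text's `ᶜ∇₄(tr X X̲̂ + conj(tr X̲)X̂) − 2ᶜ∇₄𝒜₂` is `ᶜ∇₄W` by
additivity), `+` the bracket of dropped products.
[cite: GiorgiKlainermanSzeftel2024, p0911 L36 – p0913 L4; GiorgiKlainermanSzeftel2022, l.37004–37041] -/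
theorem D87_raw [CharZero K] {D4 : Derivation ℤ K K} (N4 : CovD D4 M₁) (N4' : CovD D4 M₂)
    (Dc : Derivation ℤ K M₁) (hot : M₁ →ₗ[K] M₁ →ₗ[K] M₂) (Dhat : M₁ →+ M₂)
    (x p bb e4P e4x : K) (Hb Bb A1 T g4 Q1 : M₁) (Gg W QF Q2 : M₂)
    (hG : Gg = -(Dhat A1) - (5 : K) • hot Hb A1 - (2 * x) • hot Hb Bb - (3 / 2 * p) • W + QF)
    (hP1 : N4'.op (hot Hb A1) = hot (N4.op Hb) A1 + hot Hb (N4.op A1))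
    (hP2 : N4'.op (hot Hb Bb) = hot (N4.op Hb) Bb + hot Hb (N4.op Bb))
    (h4P : D4 p = -(3 / 2) * (x * p) + e4P) (h4x : D4 x = -(1 / 2) * (x * x) + e4x)
    (h4Hb : N4.op Hb = -(x • Hb) + g4) (hBb : N4.op Bb = -(x • Bb) - A1)
    (h82a : N4.op A1 = -((2 * x) • A1) + (1 / 2 : K) • Dc bb + (2 * bb) • Hb + T + Q1)
    (h82b : N4'.op (Dhat A1) = -((5 / 2 * x) • Dhat A1) + (3 / 2 * x) • hot Hb A1
      + (1 / 2 : K) • Dhat (Dc bb) + (5 / 2 : K) • hot Hb (Dc bb) + (Dhat T + hot Hb T) + Q2) :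
    N4'.op Gg + (5 / 2 * x) • Gg = -((1 / 2 : K) • Dhat (Dc bb)) - (5 : K) • hot Hb (Dc bb)
      - (10 * bb) • hot Hb Hb + (3 * x) • hot Hb A1 - Dhat T - (6 : K) • hot Hb T
      - (3 / 2 * p) • (N4'.op W + x • W)
      + (-((5 : K) • hot g4 A1) - (2 * x) • hot g4 Bb - (2 * e4x) • hot Hb Bb - (3 / 2 * e4P) • W
        - Q2 - (5 : K) • hot Hb Q1 + (N4'.op QF + (5 / 2 * x) • QF)) := by
  obtain ⟨h2, -, -, h5, -, h32, -⟩ := Dm_num D4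
  subst hG
  rw [map_add, map_sub, map_sub, map_sub, map_neg, h82b, N4'.leibniz, N4'.leibniz, N4'.leibniz,
    hP1, hP2, h82a, h4Hb, hBb]
  simp only [map_add, map_sub, map_neg, map_smul, D4.leibniz, h2, h5, h32, h4P, h4x,
    LinearMap.add_apply, LinearMap.smul_apply, LinearMap.neg_apply,
    smul_eq_mul, mul_zero, zero_smul, add_zero, zero_add, smul_add, smul_sub, smul_neg]
  module

/-- Lemma D.8.7, second half of the proof and the statement (`[J]` p0911 L5–34, p0913 L5 – p0914 L46 =
`[v1]` l.36997–37003, l.37043–37086).  Entering: the display reached in `D87_raw` (`ha`, its bracket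
renamed `Qa`); `T = (3/2)P·V`, `V = H̄·X̂ − conj(tr X̲)Ξ + 𝒜₃` (`hT`, `hV`, `U := H̄·X̂`); "using that
`𝒟P = −3PH̲ + O(ε)`" (`hDP`, remainder `gP`, l.37043) and "`𝒟conj(tr X̲) = (tr X̲ − conj tr X̲)H̲ +
O(ε)`" (`hDxbc`, remainder `gxbc`, l.37054) for the "second line" (l.37043–37054 = p0913 L5–76);
"Also, we have `ᶜ∇₄(tr X X̲̂ + conj(tr X̲)X̂) = …`" (l.37056–37063 = p0913 L77–118) through `hW`, the
background `ᶜ∇₄tr X` (`h4x`), the Ricci identities `ᶜ∇₄X̲̂ = −½tr X X̲̂ + 𝒜₂ − ½conj(tr X̲)X̂` (`hRicb`,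
from D.8.6) and `ᶜ∇₄X̂ = −½(tr X + conj tr X)X̂ + 𝒟⊗̂Ξ + Ξ⊗̂(H̲ + H) − A` (`hRic`), and `ᶜ∇₄conj(tr X̲)
=: n4xbc` (`hn4xbc`); "Finally, using Lemma D.8.3" in its printed form = the conclusion of the
sibling `D83` (`h83`, `XhDbHb = X̂·conj𝒟H̲`, `hh = H̲̄·H̲`, remainder `Q3`; p0914 L5); "(2.4.4) to
write `X̂·conj𝒟H̲ = X̂(conj𝒟·H̲)`" (`hrule1`, `DbHb = conj𝒟·H̲`) and "`ᶜ∇₄conj(tr X̲) = −½conj(tr X tr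
X̲) + conj𝒟·H̲ + H̲·H̲̄ + 2P + O(ε²)`" (`hN4xbc`, remainder `exbc`; p0914 L39–46 = l.37081–37085); two
silent symmetry instances (`hs1`, `hs2`).  Conclusion: the printed statement "`ᶜ∇₄𝔊 + (5/2)tr X 𝔊 =
−½𝒟⊗̂𝒟ℬ − 5H̲⊗̂𝒟ℬ − 10(H̲⊗̂H̲)ℬ + 3tr X H̲⊗̂𝒜₁ + (3/2)P conj(tr X̲)A + (3/2)P[𝒜₄ − 2B⊗̂H̲ −
𝒟⊗̂(H̄·X̂) + (conj(tr X tr X̲) − 2conj𝒟·H̲ − 2P)X̂ − 3H̲⊗̂(H̄·X̂)]`" (`conj(tr X tr X̲)` as the product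
`xc·xbc`) `+` the bracket of dropped products.  The `Ξ`-terms `−conj(tr X̲)𝒟⊗̂Ξ − (tr X̲ + 2conj tr
X̲)H̲⊗̂Ξ` of the second line cancel against those of `ᶜ∇₄(conj(tr X̲)X̂)` and of Lemma D.8.3 exactly
as "By putting all together" shows (l.37065–37080; its `ℬ₁` read `ℬ`).
[cite: GiorgiKlainermanSzeftel2024, p0911 L5–34, p0913 L5 – p0914 L46; GiorgiKlainermanSzeftel2022, l.36997–37003, l.37043–37086] -/
theorem D87_final [CharZero K] {D4 : Derivation ℤ K K} (N4' : CovD D4 M₂)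
    (Dc : Derivation ℤ K M₁) (hot : M₁ →ₗ[K] M₁ →ₗ[K] M₂) (Dhat : M₁ →+ M₂)
    (x xc xb xbc p bb hh DbHb n4xbc e4x exbc : K) (Hb H Xi B A1 A3 U T V gP gxbc : M₁)
    (Gg W A A2 A4 Xh Xbh XhDbHb Q3 Qa : M₂)
    (hDL : ∀ (f : K) (u : M₁), Dhat (f • u) = f • Dhat u + hot (Dc f) u)
    (ha : N4'.op Gg + (5 / 2 * x) • Gg = -((1 / 2 : K) • Dhat (Dc bb)) - (5 : K) • hot Hb (Dc bb)
      - (10 * bb) • hot Hb Hb + (3 * x) • hot Hb A1 - Dhat T - (6 : K) • hot Hb T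
      - (3 / 2 * p) • (N4'.op W + x • W) + Qa)
    (hT : T = (3 / 2 * p) • V) (hV : V = U - xbc • Xi + A3) (hDP : Dc p = -((3 * p) • Hb) + gP)
    (hDxbc : Dc xbc = (xb - xbc) • Hb + gxbc)
    (hW : W = x • Xbh + xbc • Xh - (2 : K) • A2) (h4x : D4 x = -(1 / 2) * (x * x) + e4x)
    (hRicb : N4'.op Xbh = -((1 / 2 * x) • Xbh) + A2 - (1 / 2 * xbc) • Xh) (hn4xbc : D4 xbc = n4xbc)
    (hRic : N4'.op Xh = -((1 / 2 * (x + xc)) • Xh) + Dhat Xi + hot Xi (Hb + H) - A)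
    (h83 : Dhat A3 - (2 : K) • N4'.op A2 = x • A2 - (3 : K) • hot Hb A3 - A4 + (2 : K) • hot B Hb
      + (xb + xbc) • hot Hb Xi - xbc • hot H Xi + XhDbHb - hh • Xh + Q3)
    (hrule1 : XhDbHb = DbHb • Xh)
    (hN4xbc : n4xbc = -(1 / 2) * (xc * xbc) + DbHb + hh + 2 * p + exbc)
    (hs1 : hot Xi Hb = hot Hb Xi) (hs2 : hot Xi H = hot H Xi) :
    N4'.op Gg + (5 / 2 * x) • Gg = -((1 / 2 : K) • Dhat (Dc bb)) - (5 : K) • hot Hb (Dc bb)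
      - (10 * bb) • hot Hb Hb + (3 * x) • hot Hb A1 + (3 / 2 * (p * xbc)) • A
      + (3 / 2 * p) • (A4 - (2 : K) • hot B Hb - Dhat U + (xc * xbc - 2 * DbHb - 2 * p) • Xh
        - (3 : K) • hot Hb U)
      + (Qa - (3 / 2 : K) • hot gP V
        + (3 / 2 * p) • (hot gxbc Xi - e4x • Xbh - exbc • Xh - Q3)) := by
  obtain ⟨-, -, -, -, -, h32, -⟩ := Dm_num Dc
  obtain ⟨h2, -, -, -, -, -, -⟩ := Dm_num D4
  have h83' := sub_eq_iff_eq_add'.mp h83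
  rw [ha]
  subst hT hV hW hrule1 hN4xbc
  simp only [map_add, map_sub, map_neg, map_smul, hDL, Dc.leibniz, hDP, hDxbc, h32, h2, h83',
    N4'.leibniz, h4x, hn4xbc, hRicb, hRic, LinearMap.add_apply, LinearMap.smul_apply,
    LinearMap.neg_apply, hs1, hs2, smul_zero, zero_smul, add_zero, zero_add, smul_add, smul_sub,
    smul_neg]
  module


/-- Lemma D.8.7, first half, with Lemma D.8.2 entering BY NAME: the hypotheses `h82a`, `h82b` of
`D87_raw` discharged by the sibling module's certified `D82_nab4_A1` (its hypotheses `hA1 … hDbP`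
verbatim: the commutator (4.2.12) for `F = P, s = 0`, the Bianchi identities for `ᶜ∇₄P`, `ᶜ∇₃P`,
`conj𝒟P`) and `D82_nab4_Dhat_A1` / `D82_nab4_Dhat_A1_printed` (`hDL`, `hA2`, `hcommA` = (4.2.13) for
`F = 𝒜₁, s = 0`, `hsym`, `hDx`), so that `T = (3/2)P(X̂·H̄ − conj(tr X̲)Ξ + 𝒜₃)` and the brackets
`Q1 = e3·Ξ − ½X̂·gPb`, `Q2 = 𝒟⊗̂Q1 + H̲⊗̂Q1 + (2ℬ𝒜₂ − 2gx⊗̂𝒜₁ + g₄)` are those the kernel certified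
for Lemma D.8.2.  "Using Lemma D.8.2 to for the derivatives of `𝒜₁`, we now compute" (`[J]` p0912
L2 – p0913 L4 = `[v1]` l.37019–37041).
[cite: GiorgiKlainermanSzeftel2024, p0900 L40 – p0901 L109, p0912 L2 – p0913 L4; GiorgiKlainermanSzeftel2022, l.36587–36657, l.37019–37041] -/
theorem D87_raw_of_D82 [CharZero K] {D4 : Derivation ℤ K K} (N4 : CovD D4 M₁) (N4' : CovD D4 M₂)
    (Dc : Derivation ℤ K M₁) (hot : M₁ →ₗ[K] M₁ →ₗ[K] M₂) (Dhat : M₁ →+ M₂) (Xc : M₁ →ₗ[K] M₁)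
    (x xbc p bb divBc HbBc n3p e3 e4P e4x : K) (Hb Hc Xi Bb A1 A3 DbP gPb g4 gx : M₁)
    (Gg W QF A2 g₄ : M₂)
    (hG : Gg = -(Dhat A1) - (5 : K) • hot Hb A1 - (2 * x) • hot Hb Bb - (3 / 2 * p) • W + QF)
    (hP1 : N4'.op (hot Hb A1) = hot (N4.op Hb) A1 + hot Hb (N4.op A1))
    (hP2 : N4'.op (hot Hb Bb) = hot (N4.op Hb) Bb + hot Hb (N4.op Bb))
    (h4P : D4 p = -(3 / 2) * (x * p) + e4P) (h4x : D4 x = -(1 / 2) * (x * x) + e4x)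
    (h4Hb : N4.op Hb = -(x • Hb) + g4) (hBb : N4.op Bb = -(x • Bb) - A1)
    (hA1 : A1 = Dc p + (3 * p) • Hb) (hA3 : A3 = (2 : K) • N4.op Hb - Dc x)
    (hbb : bb = divBc + 2 * HbBc)
    (hcommP : N4.op (Dc p) = Dc (D4 p) - (1 / 2 * x) • Dc p + D4 p • Hb - (1 / 2 : K) • Xc DbP
      + n3p • Xi)
    (hBP : D4 p = -(3 / 2) * (x * p) + 1 / 2 * divBc + HbBc)
    (h3P : n3p = -(3 / 2) * (xbc * p) + e3) (hDbP : DbP = -((3 * p) • Hc) + gPb)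
    (hDL : ∀ (f : K) (u : M₁), Dhat (f • u) = f • Dhat u + hot (Dc f) u)
    (hA2 : A2 = Dhat Hb + hot Hb Hb)
    (hcommA : N4'.op (Dhat A1) = Dhat (N4.op A1) - (1 / 2 * x) • (Dhat A1 + hot Hb A1)
      + hot Hb (N4.op A1) + g₄)
    (hsym : hot (Dc bb) Hb = hot Hb (Dc bb)) (hDx : Dc x = -((2 * x) • Hb) + gx) :
    N4'.op Gg + (5 / 2 * x) • Gg = -((1 / 2 : K) • Dhat (Dc bb)) - (5 : K) • hot Hb (Dc bb)
      - (10 * bb) • hot Hb Hb + (3 * x) • hot Hb A1 - Dhat ((3 / 2 * p) • (Xc Hc - xbc • Xi + A3))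
      - (6 : K) • hot Hb ((3 / 2 * p) • (Xc Hc - xbc • Xi + A3))
      - (3 / 2 * p) • (N4'.op W + x • W)
      + (-((5 : K) • hot g4 A1) - (2 * x) • hot g4 Bb - (2 * e4x) • hot Hb Bb - (3 / 2 * e4P) • W
        - (Dhat (e3 • Xi - (1 / 2 : K) • Xc gPb) + hot Hb (e3 • Xi - (1 / 2 : K) • Xc gPb)
            + ((2 * bb) • A2 - (2 : K) • hot gx A1 + g₄))
        - (5 : K) • hot Hb (e3 • Xi - (1 / 2 : K) • Xc gPb) + (N4'.op QF + (5 / 2 * x) • QF)) := by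
  have h82a := D82_nab4_A1 N4 Dc Xc x xbc p divBc HbBc bb n3p e3 A1 A3 Hb Hc Xi DbP gPb hA1 hA3 hbb
    hcommP hBP h3P hDbP
  have hi' : N4.op A1 = -((2 * x) • A1) + (1 / 2 : K) • Dc bb + (2 * bb) • Hb
      + ((3 / 2 * p) • (Xc Hc - xbc • Xi + A3) + (e3 • Xi - (1 / 2 : K) • Xc gPb)) := by
    rw [h82a]; abel
  have hraw := D82_nab4_Dhat_A1 N4 N4' Dc hot Dhat x bb A1 Hb _ A2 g₄ hDL hA2 hcommA hi' hsym
  have h82b := D82_nab4_Dhat_A1_printed hot Dhat x bb A1 Hb _ (Dc x) (Dc bb) gx A2 g₄ _ hraw hDx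
  have h82b' : N4'.op (Dhat A1) = -((5 / 2 * x) • Dhat A1) + (3 / 2 * x) • hot Hb A1
      + (1 / 2 : K) • Dhat (Dc bb) + (5 / 2 : K) • hot Hb (Dc bb)
      + (Dhat ((3 / 2 * p) • (Xc Hc - xbc • Xi + A3)) + hot Hb ((3 / 2 * p) • (Xc Hc - xbc • Xi + A3)))
      + (Dhat (e3 • Xi - (1 / 2 : K) • Xc gPb) + hot Hb (e3 • Xi - (1 / 2 : K) • Xc gPb)
          + ((2 * bb) • A2 - (2 : K) • hot gx A1 + g₄)) := by
    rw [h82b]; simp only [map_add]; abel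
  exact D87_raw N4 N4' Dc hot Dhat x p bb e4P e4x Hb Bb A1 _ g4 _ Gg W QF _ hG hP1 hP2 h4P h4x h4Hb
    hBb h82a h82b'

/-- Lemma D.8.7, second half, with Lemma D.8.3 entering BY NAME: the hypothesis `h83` of `D87_final`
discharged by the sibling module's certified `D83` (its hypotheses verbatim: `hA2`, `hA3`, `hA4`, the
product rule `hprod`, the commutator (4.2.13) for `F = H̲, s = 0` `hcomm`, the Bianchi identity for
`ᶜ∇₃H̲` `h3`, the symmetry instances), so that the bracket `Q3 = −2Ξ⊗̂g₃` is the one the kernel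
certified for Lemma D.8.3.  "Finally, using Lemma D.8.3 to write …" (`[J]` p0914 L5–46 = `[v1]`
l.37073–37086).
[cite: GiorgiKlainermanSzeftel2024, p0901 L1–30, p0914 L5–46; GiorgiKlainermanSzeftel2022, l.36608–36657, l.37073–37086] -/
theorem D87_final_of_D83 [CharZero K] {D4 : Derivation ℤ K K} (N4 : CovD D4 M₁) (N4' : CovD D4 M₂)
    (Dc : Derivation ℤ K M₁) (hot : M₁ →ₗ[K] M₁ →ₗ[K] M₂) (Dhat : M₁ →+ M₂)
    (x xc xb xbc p bb hh DbHb n4xbc e4x exbc : K) (Hb H Xi B A1 A3 U T V gP gxbc n3Hb g₃ : M₁)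
    (Gg W A A2 A4 Xh Xbh XhDbHb Qa : M₂)
    (hDL : ∀ (f : K) (u : M₁), Dhat (f • u) = f • Dhat u + hot (Dc f) u)
    (ha : N4'.op Gg + (5 / 2 * x) • Gg = -((1 / 2 : K) • Dhat (Dc bb)) - (5 : K) • hot Hb (Dc bb)
      - (10 * bb) • hot Hb Hb + (3 * x) • hot Hb A1 - Dhat T - (6 : K) • hot Hb T
      - (3 / 2 * p) • (N4'.op W + x • W) + Qa)
    (hT : T = (3 / 2 * p) • V) (hV : V = U - xbc • Xi + A3) (hDP : Dc p = -((3 * p) • Hb) + gP)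
    (hDxbc : Dc xbc = (xb - xbc) • Hb + gxbc)
    (hW : W = x • Xbh + xbc • Xh - (2 : K) • A2) (h4x : D4 x = -(1 / 2) * (x * x) + e4x)
    (hRicb : N4'.op Xbh = -((1 / 2 * x) • Xbh) + A2 - (1 / 2 * xbc) • Xh) (hn4xbc : D4 xbc = n4xbc)
    (hRic : N4'.op Xh = -((1 / 2 * (x + xc)) • Xh) + Dhat Xi + hot Xi (Hb + H) - A)
    (hA2 : A2 = Dhat Hb + hot Hb Hb) (hA3 : A3 = (2 : K) • N4.op Hb - Dc x)
    (hA4 : A4 = Dhat (Dc x) + (3 : K) • hot Hb (Dc x))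
    (hprod : N4'.op (hot Hb Hb) = hot (N4.op Hb) Hb + hot Hb (N4.op Hb))
    (hcomm : N4'.op (Dhat Hb) = Dhat (N4.op Hb) - (1 / 2 * x) • (Dhat Hb + hot Hb Hb)
      + hot Hb (N4.op Hb) + hot Xi n3Hb - hot B Hb - (1 / 2 * xb) • hot Xi Hb - (1 / 2 : K) • XhDbHb
      + (1 / 2 * hh) • Xh)
    (h3 : n3Hb = -((1 / 2 * xbc) • (Hb - H)) + g₃)
    (hs0 : hot (N4.op Hb) Hb = hot Hb (N4.op Hb))
    (hrule1 : XhDbHb = DbHb • Xh)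
    (hN4xbc : n4xbc = -(1 / 2) * (xc * xbc) + DbHb + hh + 2 * p + exbc)
    (hs1 : hot Xi Hb = hot Hb Xi) (hs2 : hot Xi H = hot H Xi) :
    N4'.op Gg + (5 / 2 * x) • Gg = -((1 / 2 : K) • Dhat (Dc bb)) - (5 : K) • hot Hb (Dc bb)
      - (10 * bb) • hot Hb Hb + (3 * x) • hot Hb A1 + (3 / 2 * (p * xbc)) • A
      + (3 / 2 * p) • (A4 - (2 : K) • hot B Hb - Dhat U + (xc * xbc - 2 * DbHb - 2 * p) • Xh
        - (3 : K) • hot Hb U)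
      + (Qa - (3 / 2 : K) • hot gP V
        + (3 / 2 * p) • (hot gxbc Xi - e4x • Xbh - exbc • Xh - (-((2 : K) • hot Xi g₃)))) := by
  have h := D83 N4 N4' Dc hot Dhat x xb xbc hh Hb H Xi B n3Hb g₃ A3 A2 A4 XhDbHb Xh hDL hA2 hA3 hA4
    hprod hcomm h3 hs0 hs1 hs2
  have h83 : Dhat A3 - (2 : K) • N4'.op A2 = x • A2 - (3 : K) • hot Hb A3 - A4 + (2 : K) • hot B Hb
      + (xb + xbc) • hot Hb Xi - xbc • hot H Xi + XhDbHb - hh • Xh + (-((2 : K) • hot Xi g₃)) := by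
    rw [h]; abel
  exact D87_final N4' Dc hot Dhat x xc xb xbc p bb hh DbHb n4xbc e4x exbc Hb H Xi B A1 A3 U T V gP
    gxbc Gg W A A2 A4 Xh Xbh XhDbHb _ Qa hDL ha hT hV hDP hDxbc hW h4x hRicb hn4xbc hRic h83 hrule1
    hN4xbc hs1 hs2

/-- The splitting of `ℌ` and (D.8.3) = (nabc4mathfrakH) (`[J]` p0914 L48–105 = `[v1]` l.37096–37112):
"Define `ℌ := ᶜ∇₄𝔊 + (5/2)tr X 𝔊`.  We infer from Lemma D.8.7, `ℌ = ℌ₁ + (3/2)Pℌ₂ + (3/2)P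
conj(tr X̲)A` with `ℌ₁ = −½𝒟⊗̂𝒟ℬ − 5H̲⊗̂𝒟ℬ − 10(H̲⊗̂H̲)ℬ + 3tr X H̲⊗̂𝒜₁`, `ℌ₂ = 𝒜₄ − 2B⊗̂H̲ −
𝒟⊗̂(H̄·X̂) + (conj(tr X tr X̲) − 2conj𝒟·H̲ − 2P)X̂ − 3H̲⊗̂(H̄·X̂)` (`hsplit`).  This gives, using that
`ᶜ∇₄P = −(3/2)tr X P`, `ᶜ∇₄ℌ = ᶜ∇₄ℌ₁ + (3/2)P[ᶜ∇₄ℌ₂ − (3/2)tr X ℌ₂] + ᶜ∇₄((3/2)P conj(tr X̲)A)`."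
With the background remainder `e4P` of `ᶜ∇₄P` (`h4P`) the display acquires `+ (3/2)e4P·ℌ₂`.
[cite: GiorgiKlainermanSzeftel2024, p0914 L48–105; GiorgiKlainermanSzeftel2022, l.37096–37112] -/
theorem nab4_frakH [CharZero K] {D4 : Derivation ℤ K K} (N4' : CovD D4 M₂)
    (x xbc p e4P : K) (Hh H1 H2 A : M₂)
    (hsplit : Hh = H1 + (3 / 2 * p) • H2 + (3 / 2 * (p * xbc)) • A)
    (h4P : D4 p = -(3 / 2) * (x * p) + e4P) :
    N4'.op Hh = N4'.op H1 + (3 / 2 * p) • (N4'.op H2 - (3 / 2 * x) • H2)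
      + N4'.op ((3 / 2 * (p * xbc)) • A) + (3 / 2 * e4P) • H2 := by
  obtain ⟨-, -, -, -, -, h32, -⟩ := Dm_num D4
  subst hsplit
  rw [map_add, map_add, N4'.leibniz ((3 : K) / 2 * p)]
  simp only [D4.leibniz, h32, h4P, smul_eq_mul, mul_zero, add_zero, smul_sub]
  module

/-! ## §2b Lemma D.8.8 (`[v1]` Lemma `nabc4mathfrak1`) — `ᶜ∇₄ℌ₁` -/

/-- Lemma D.8.8, displays 1–3 of the proof (`[J]` p0915 L44 – p0916 L63 = `[v1]` l.37130–37161).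
Entering: "From the definition of `ℌ₁`" (`hH1`, l.37106) by the product rules (`hprodD`, `hprodHH`,
`hprodA`) and "`ᶜ∇₄H̲ = −tr X H̲ + O(ε)` and `ᶜ∇₄tr X = −½(tr X)² + O(ε)`" (`h4Hb`, `h4x`, remainders
`g4`, `e4x`; l.37138 = p0915 L76); "Using Lemma D.8.5 and Lemma D.8.2" (l.37140 = p0915 L77): the
three identities of D.8.5 in the shape of the sibling module's conclusions `D85_nab4_B`,
`D85_nab4_DB`, `D85_nab4_DhatDB` (`hi`, `hii`, `hiii`; `bb = ℬ`, `HbBc = H̲·B̄`, `d = 𝒟·Ξ̄`, `Dc d =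
𝒟𝒟·Ξ̄`, `W' = (𝒟 + 3H̲)·(𝒟·Ā + Ā·H̲)`, `E' = (𝒟 + H̲)(W')`, `Z = −8tr X(H̲·B̄)H̲ + 3P𝒟𝒟·Ξ̄ −
6P(𝒟·Ξ̄)H̲` (`hZ`), remainders `R1`, `R2`, `R3`) and the first identity of D.8.2 as printed (`h82`,
`U = H̄·X̂`, remainder `R82`); `Expr₂(A) = −¼(𝒟 + 11H̲)⊗̂(E') − 5(H̲⊗̂H̲)W'` (`hE2`, l.37124–37128).
Conclusion: the display "We simplify the above to" (l.37155–37161 = p0916 L23–63): `ᶜ∇₄ℌ₁ = (7/4)tr X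
𝒟⊗̂𝒟ℬ + (35/2)tr X H̲⊗̂𝒟ℬ + 31tr X(H̲⊗̂H̲)ℬ − (21/2)(tr X)²H̲⊗̂𝒜₁ − ½(𝒟 + 11H̲)⊗̂[Z] − 10(H̲⊗̂H̲)[2tr
X H̲·B̄ + 3P𝒟·Ξ̄] + (3/2)P·3tr X H̲⊗̂[H̄·X̂ − conj(tr X̲)Ξ + 𝒜₃] + Expr₂(A)`, `+` the bracket `RA` of
dropped products.
[cite: GiorgiKlainermanSzeftel2024, p0915 L44 – p0916 L63; GiorgiKlainermanSzeftel2022, l.37130–37161] -/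
theorem D88_expand [CharZero K] {D4 : Derivation ℤ K K} (N4 : CovD D4 M₁) (N4' : CovD D4 M₂)
    (Dc : Derivation ℤ K M₁) (hot : M₁ →ₗ[K] M₁ →ₗ[K] M₂) (Dhat : M₁ →+ M₂)
    (x p bb HbBc d W' xbc e4x R1 : K) (Hb A1 A3 U Xi Z E' g4 R2 R82 : M₁) (H1 E2 R3 : M₂)
    (hH1 : H1 = -((1 / 2 : K) • Dhat (Dc bb)) - (5 : K) • hot Hb (Dc bb) - (10 * bb) • hot Hb Hb
      + (3 * x) • hot Hb A1)
    (hprodD : N4'.op (hot Hb (Dc bb)) = hot (N4.op Hb) (Dc bb) + hot Hb (N4.op (Dc bb)))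
    (hprodHH : N4'.op (hot Hb Hb) = hot (N4.op Hb) Hb + hot Hb (N4.op Hb))
    (hprodA : N4'.op (hot Hb A1) = hot (N4.op Hb) A1 + hot Hb (N4.op A1))
    (h4Hb : N4.op Hb = -(x • Hb) + g4) (h4x : D4 x = -(1 / 2) * (x * x) + e4x)
    (hiii : N4'.op (Dhat (Dc bb)) = -((7 / 2 * x) • Dhat (Dc bb)) + (8 * x) • hot Hb (Dc bb)
      - (10 * x * bb) • hot Hb Hb + (Dhat Z + hot Hb Z) + (1 / 2 : K) • (Dhat E' + hot Hb E') + R3)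
    (hii : N4.op (Dc bb) = -((3 * x) • Dc bb) + (5 * x * bb) • Hb - (8 * x * HbBc) • Hb
      + (3 * p) • Dc d - (6 * p * d) • Hb + (1 / 2 : K) • E' + R2)
    (hZ : Z = -((8 * x * HbBc) • Hb) + (3 * p) • Dc d - (6 * p * d) • Hb)
    (hi : D4 bb = -(5 / 2 * x * bb) + 2 * x * HbBc + 3 * p * d + 1 / 2 * W' + R1)
    (h82 : N4.op A1 = -((2 * x) • A1) + (1 / 2 : K) • Dc bb + (2 * bb) • Hb
      + (3 / 2 * p) • (U - xbc • Xi + A3) + R82)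
    (hE2 : E2 = -((1 / 4 : K) • (Dhat E' + (11 : K) • hot Hb E')) - (5 * W') • hot Hb Hb) :
    N4'.op H1 = (7 / 4 * x) • Dhat (Dc bb) + (35 / 2 * x) • hot Hb (Dc bb)
      + (31 * x * bb) • hot Hb Hb - (21 / 2 * (x * x)) • hot Hb A1
      - (1 / 2 : K) • (Dhat Z + (11 : K) • hot Hb Z) - (10 : K) • ((2 * x * HbBc + 3 * p * d) • hot Hb Hb)
      + (3 / 2 * p * (3 * x)) • hot Hb (U - xbc • Xi + A3) + E2
      + (-((1 / 2 : K) • R3) - (5 : K) • hot Hb R2 - (5 : K) • hot g4 (Dc bb) - (10 * R1) • hot Hb Hb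
        - (10 * bb) • (hot g4 Hb + hot Hb g4) + (3 * x) • hot Hb R82 + (3 * x) • hot g4 A1
        + (3 * e4x) • hot Hb A1) := by
  obtain ⟨h2, h3, -, h5, h12, -, -⟩ := Dm_num D4
  have h10 : D4 (10 : K) = 0 := by
    rw [show (10 : K) = 2 * 5 by norm_num, D4.leibniz, h2, h5, smul_zero, smul_zero, add_zero]
  subst hH1 hE2 hZ
  rw [map_add, map_sub, map_sub, map_neg, N4'.leibniz, N4'.leibniz, N4'.leibniz, N4'.leibniz, hiii,
    hprodD, hprodHH, hprodA, hii, h82, h4Hb]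
  simp only [map_add, map_sub, map_neg, map_smul, D4.leibniz, hi, h3, h5, h10, h12, h4x,
    LinearMap.add_apply, LinearMap.neg_apply, LinearMap.smul_apply,
    smul_eq_mul, mul_zero, add_zero, zero_smul, zero_add, smul_add, smul_sub, smul_neg]
  module

/-- Lemma D.8.8, displays 1–3, with Lemma D.8.5 and Lemma D.8.2 entering BY NAME: the hypotheses `hi`,
`hii`, `hiii`, `h82` of `D88_expand` discharged by the sibling module's certified `D85_nab4_B`,
`D85_nab4_DB`, `D85_nab4_DhatDB` and `D82_nab4_A1` (their hypotheses verbatim: the definition of `ℬ`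
over the pairing `pair` and `Ddot = 𝒟·`, the product rule `hLeib`, the commutators (4.2.16) for `F =
B̄, s = 1` (`hcommB`), (4.2.12) for `F = ℬ` (`hcommDB`) and `F = P` (`hcommP`), (4.2.13) for `F = 𝒟ℬ`
(`hcommDD`), the Bianchi identities for `ᶜ∇₄B̄` (`hBianchi`, `W = 𝒟·Ā + Ā·H̲`), `ᶜ∇₄P` (`hBP`), `ᶜ∇₃P`
(`h3P`), `conj𝒟P` (`hDbP`), the Leibniz rule of `𝒟·` (`hDdL`), the displayed expansion of `𝒟(H̲·B̄)`
(`hLHB`, `hDHbB`), the backgrounds `hDx`, `h4Hb`, `hDP`), with `HbBc = pair Hb Bc`, `d = 𝒟·Ξ̄ = Ddot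
Xic`, `U = X̂·H̄ = Xc Hc`, and the abbreviations `W' = 𝒟·W + 3H̲·W` (`hW'`), `E' = 𝒟W' + W'H̲` (`hE'`)
and `R1`, `R2`, `R3` = the brackets the kernel certified for D.8.5 (i), (ii), (iii), propagated
(`hR1`, `hR2`, `hR3`); `R82 = e3·Ξ − ½X̂·gPb` is D.8.2's.  "Using Lemma D.8.5 to compute `ᶜ∇₄𝒟⊗̂𝒟ℬ`,
`ᶜ∇₄(𝒟ℬ)`, `ᶜ∇₄ℬ`, and Lemma D.8.2 to compute `ᶜ∇₄𝒜₁`" (`[J]` p0915 L77 – p0916 L63 = `[v1]`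
l.37140–37161).
[cite: GiorgiKlainermanSzeftel2024, p0905 L100 – p0908 L60, p0915 L44 – p0916 L63; GiorgiKlainermanSzeftel2022, l.36793–36905, l.37130–37161] -/
theorem D88_expand_of_D85 [CharZero K] {D4 : Derivation ℤ K K} (N4 : CovD D4 M₁) (N4' : CovD D4 M₂)
    (Dc : Derivation ℤ K M₁) (hot : M₁ →ₗ[K] M₁ →ₗ[K] M₂) (Dhat : M₁ →+ M₂) (Xc : M₁ →ₗ[K] M₁)
    (Ddot : M₁ →+ K) (pair : M₁ →ₗ[K] M₁ →ₗ[K] K)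
    (x xbc p bb gcm n3p e3 e4x W' R1 : K)
    (Hb Hc Bc Xic Xi W A1 A3 Z DHbB DbP gPb gx g4 gP gH gc E' R2 : M₁) (H1 E2 A2 g₄ R3 : M₂)
    (hH1 : H1 = -((1 / 2 : K) • Dhat (Dc bb)) - (5 : K) • hot Hb (Dc bb) - (10 * bb) • hot Hb Hb
      + (3 * x) • hot Hb A1)
    (hprodD : N4'.op (hot Hb (Dc bb)) = hot (N4.op Hb) (Dc bb) + hot Hb (N4.op (Dc bb)))
    (hprodHH : N4'.op (hot Hb Hb) = hot (N4.op Hb) Hb + hot Hb (N4.op Hb))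
    (hprodA : N4'.op (hot Hb A1) = hot (N4.op Hb) A1 + hot Hb (N4.op A1))
    (h4Hb : N4.op Hb = -(x • Hb) + g4) (h4x : D4 x = -(1 / 2) * (x * x) + e4x)
    (hbb : bb = Ddot Bc + 2 * pair Hb Bc)
    (hLeib : D4 (pair Hb Bc) = pair (N4.op Hb) Bc + pair Hb (N4.op Bc))
    (hcommB : D4 (Ddot Bc) = Ddot (N4.op Bc) - 1 / 2 * x * (Ddot Bc - 2 * pair Hb Bc)
      + pair Hb (N4.op Bc) + gcm)
    (hBianchi : N4.op Bc = -((2 * x) • Bc) + (3 * p) • Xic + (1 / 2 : K) • W)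
    (hDdL : ∀ (f : K) (u : M₁), Ddot (f • u) = f * Ddot u + pair (Dc f) u)
    (hDx : Dc x = -((2 * x) • Hb) + gx) (hDP : Dc p = -((3 * p) • Hb) + gP)
    (hcommDB : N4.op (Dc bb) = Dc (D4 bb) - (1 / 2 * x) • (Dc bb - bb • Hb) + D4 bb • Hb + gc)
    (hLHB : Dc (pair Hb Bc) = DHbB + Ddot Bc • Hb) (hDHbB : DHbB = -(pair Hb Bc • Hb) + gH)
    (hDL : ∀ (f : K) (u : M₁), Dhat (f • u) = f • Dhat u + hot (Dc f) u)
    (hcommDD : N4'.op (Dhat (Dc bb)) = Dhat (N4.op (Dc bb)) - (1 / 2 * x) • Dhat (Dc bb)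
      + hot Hb (N4.op (Dc bb)) + g₄)
    (hA2 : A2 = Dhat Hb + hot Hb Hb) (hs : hot (Dc bb) Hb = hot Hb (Dc bb))
    (hZ : Z = -((8 * x * pair Hb Bc) • Hb) + (3 * p) • Dc (Ddot Xic) - (6 * p * Ddot Xic) • Hb)
    (hA1 : A1 = Dc p + (3 * p) • Hb) (hA3 : A3 = (2 : K) • N4.op Hb - Dc x)
    (hcommP : N4.op (Dc p) = Dc (D4 p) - (1 / 2 * x) • Dc p + D4 p • Hb - (1 / 2 : K) • Xc DbP
      + n3p • Xi)
    (hBP : D4 p = -(3 / 2) * (x * p) + 1 / 2 * Ddot Bc + pair Hb Bc)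
    (h3P : n3p = -(3 / 2) * (xbc * p) + e3) (hDbP : DbP = -((3 * p) • Hc) + gPb)
    (hW' : W' = Ddot W + 3 * pair Hb W) (hE' : E' = Dc W' + W' • Hb)
    (hR1 : R1 = -(2 * pair gx Bc) + 2 * pair g4 Bc + 3 * pair gP Xic + gcm)
    (hR2 : R2 = Dc R1 + R1 • Hb + (-((5 / 2 * bb) • gx) + (2 * x) • gH + (2 * pair Hb Bc) • gx
      + (3 * Ddot Xic) • gP + gc))
    (hR3 : R3 = Dhat R2 + hot Hb R2
      + (-((3 : K) • hot gx (Dc bb)) + (5 * bb) • hot gx Hb + (5 * x * bb) • A2 + g₄))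
    (hE2 : E2 = -((1 / 4 : K) • (Dhat E' + (11 : K) • hot Hb E')) - (5 * W') • hot Hb Hb) :
    N4'.op H1 = (7 / 4 * x) • Dhat (Dc bb) + (35 / 2 * x) • hot Hb (Dc bb)
      + (31 * x * bb) • hot Hb Hb - (21 / 2 * (x * x)) • hot Hb A1
      - (1 / 2 : K) • (Dhat Z + (11 : K) • hot Hb Z)
      - (10 : K) • ((2 * x * pair Hb Bc + 3 * p * Ddot Xic) • hot Hb Hb)
      + (3 / 2 * p * (3 * x)) • hot Hb (Xc Hc - xbc • Xi + A3) + E2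
      + (-((1 / 2 : K) • R3) - (5 : K) • hot Hb R2 - (5 : K) • hot g4 (Dc bb) - (10 * R1) • hot Hb Hb
        - (10 * bb) • (hot g4 Hb + hot Hb g4) + (3 * x) • hot Hb (e3 • Xi - (1 / 2 : K) • Xc gPb)
        + (3 * x) • hot g4 A1 + (3 * e4x) • hot Hb A1) := by
  obtain ⟨-, -, -, -, h12, -, -⟩ := Dm_num Dc
  have hB := D85_nab4_B N4 Dc Ddot pair x p bb gcm Hb Bc Xic W gx g4 gP hbb hLeib hcommB hBianchi hDdL
    hDx h4Hb hDP
  have hi : D4 bb = -(5 / 2 * x * bb) + 2 * x * pair Hb Bc + 3 * p * Ddot Xic + 1 / 2 * W' + R1 := by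
    rw [hB, hW', hR1]; ring
  have hi2 : D4 bb = -(5 / 2 * x * bb) + 2 * x * pair Hb Bc + 3 * p * Ddot Xic
      + (1 / 2 * W' + R1) := by
    rw [hi]; ring
  have hdiv : Ddot Bc = bb - 2 * pair Hb Bc := by rw [hbb]; ring
  have hDBth := D85_nab4_DB N4 Dc x p bb (pair Hb Bc) (Ddot Bc) (Ddot Xic) (1 / 2 * W' + R1) Hb DHbB
    gx gP gH gc hcommDB hi2 hLHB hDHbB hdiv hDx hDP
  have hw : Dc (1 / 2 * W' + R1) = (1 / 2 : K) • Dc W' + Dc R1 := by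
    rw [map_add, Dc.leibniz, h12, smul_zero, add_zero]
  have hii : N4.op (Dc bb) = -((3 * x) • Dc bb) + (5 * x * bb) • Hb - (8 * x * pair Hb Bc) • Hb
      + (3 * p) • Dc (Ddot Xic) - (6 * p * Ddot Xic) • Hb + (1 / 2 : K) • E' + R2 := by
    rw [hDBth, hw, hE', hR2]; module
  have hii2 : N4.op (Dc bb) = -((3 * x) • Dc bb) + (5 * x * bb) • Hb + Z
      + ((1 / 2 : K) • E' + R2) := by
    rw [hii, hZ]; abel
  have hDDth := D85_nab4_DhatDB N4 N4' Dc hot Dhat x bb Hb (Dc bb) Z ((1 / 2 : K) • E' + R2) gx A2 g₄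
    hDL hcommDD hii2 rfl hDx hA2 hs
  have hiii : N4'.op (Dhat (Dc bb)) = -((7 / 2 * x) • Dhat (Dc bb)) + (8 * x) • hot Hb (Dc bb)
      - (10 * x * bb) • hot Hb Hb + (Dhat Z + hot Hb Z) + (1 / 2 : K) • (Dhat E' + hot Hb E')
      + R3 := by
    rw [hDDth, hR3, map_add Dhat, hDL, h12, map_zero, LinearMap.zero_apply, add_zero]
    simp only [map_add, map_smul]
    module
  have h82 := D82_nab4_A1 N4 Dc Xc x xbc p (Ddot Bc) (pair Hb Bc) bb n3p e3 A1 A3 Hb Hc Xi DbP gPb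
    hA1 hA3 hbb hcommP hBP h3P hDbP
  exact D88_expand N4 N4' Dc hot Dhat x p bb (pair Hb Bc) (Ddot Xic) W' xbc e4x R1 Hb A1 A3 (Xc Hc)
    Xi Z E' g4 R2 _ H1 E2 R3 hH1 hprodD hprodHH hprodA h4Hb h4x hiii hii hZ hi h82 hE2

/-- Lemma D.8.8, display 4 (`[J]` p0916 L64–91 = `[v1]` l.37162–37169): "By writing `½𝒟⊗̂𝒟ℬ = −ℌ₁ −
5H̲⊗̂𝒟ℬ − 10(H̲⊗̂H̲)ℬ + 3tr X H̲⊗̂𝒜₁`, and re-organizing": from display 3 (`hN`, bracket `RA`),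
`hH1` and `hZ`: `ᶜ∇₄ℌ₁ + (7/2)tr X ℌ₁ = −4tr X(H̲⊗̂H̲)ℬ + 4(𝒟 + 11H̲)⊗̂[tr X H̲(H̲·B̄)] − 20tr
X(H̲⊗̂H̲)(H̲·B̄) − (3/2)(𝒟 + 11H̲)⊗̂[P𝒟𝒟·Ξ̄ − 2H̲P𝒟·Ξ̄] − 30P(H̲⊗̂H̲)𝒟·Ξ̄ + (3/2)P·3tr X H̲⊗̂[H̄·X̂ −
conj(tr X̲)Ξ + 𝒜₃] + Expr₂(A)` (`+ RA`).  EXACT — a re-arrangement, the Leibniz rule of `𝒟⊗̂` (`hDL`)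
serving only to move numerals through `𝒟⊗̂`.
[cite: GiorgiKlainermanSzeftel2024, p0916 L64–91; GiorgiKlainermanSzeftel2022, l.37162–37169] -/
theorem D88_reorganize [CharZero K] (Dc : Derivation ℤ K M₁) (hot : M₁ →ₗ[K] M₁ →ₗ[K] M₂)
    (Dhat : M₁ →+ M₂) (x p bb HbBc d xbc : K) (Hb A1 A3 U Xi Z : M₁) (H1 E2 N RA : M₂)
    (hDL : ∀ (f : K) (u : M₁), Dhat (f • u) = f • Dhat u + hot (Dc f) u)
    (hH1 : H1 = -((1 / 2 : K) • Dhat (Dc bb)) - (5 : K) • hot Hb (Dc bb) - (10 * bb) • hot Hb Hb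
      + (3 * x) • hot Hb A1)
    (hN : N = (7 / 4 * x) • Dhat (Dc bb) + (35 / 2 * x) • hot Hb (Dc bb)
      + (31 * x * bb) • hot Hb Hb - (21 / 2 * (x * x)) • hot Hb A1
      - (1 / 2 : K) • (Dhat Z + (11 : K) • hot Hb Z) - (10 : K) • ((2 * x * HbBc + 3 * p * d) • hot Hb Hb)
      + (3 / 2 * p * (3 * x)) • hot Hb (U - xbc • Xi + A3) + E2 + RA)
    (hZ : Z = -((8 * x * HbBc) • Hb) + (3 * p) • Dc d - (6 * p * d) • Hb) :
    N + (7 / 2 * x) • H1 = -((4 * x * bb) • hot Hb Hb)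
      + (4 : K) • (Dhat ((x * HbBc) • Hb) + (11 : K) • hot Hb ((x * HbBc) • Hb))
      - (20 * x * HbBc) • hot Hb Hb
      - (3 / 2 : K) • (Dhat (p • Dc d - (2 * p * d) • Hb) + (11 : K) • hot Hb (p • Dc d - (2 * p * d) • Hb))
      - (30 * p * d) • hot Hb Hb
      + (3 / 2 * p * (3 * x)) • hot Hb (U - xbc • Xi + A3) + E2 + RA := by
  obtain ⟨h2, h3, h4, -, -, -, -⟩ := Dm_num Dc
  have h6 : Dc (6 : K) = 0 := by
    rw [show (6 : K) = 2 * 3 by norm_num, Dc.leibniz, h2, h3, smul_zero, smul_zero, add_zero]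
  have h8 : Dc (8 : K) = 0 := by
    rw [show (8 : K) = 2 * 4 by norm_num, Dc.leibniz, h2, h4, smul_zero, smul_zero, add_zero]
  subst hH1 hN hZ
  simp only [map_add, map_sub, map_neg, map_smul, hDL, Dc.leibniz, h2, h3, h6, h8,
    LinearMap.add_apply, LinearMap.smul_apply, smul_zero, add_zero, smul_add, smul_sub, smul_neg]
  module

/-- Lemma D.8.8, display 5 (`[J]` p0916 L92 – p0917 L7 = `[v1]` l.37170–37181): "We now simplify the
second line.  `4(𝒟 + 11H̲)⊗̂[tr X H̲(H̲·B̄)] − 20tr X(H̲⊗̂H̲)(H̲·B̄) = … = 4tr X H̲⊗̂H̲(𝒟·B̄) + 8tr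
X(H̲⊗̂H̲)(H̲·B̄) = 4tr X(H̲⊗̂H̲)ℬ`".  Entering: the Leibniz rule of `𝒟⊗̂` (`hDL`); "`𝒟(tr X) = −2tr X H̲
+ O(ε)`" (`hDx`, remainder `gx`) and "`𝒟⊗̂H̲ = −H̲⊗̂H̲ + O(ε)`" entered as the definition of `𝒜₂`
(`hA2`, `𝒜₂` dropped by the text) (l.37181 = p0917 L7); the displayed expansion `𝒟(H̲·B̄) ↦ 𝒟H̲·B̄ +
H̲(𝒟·B̄)` (`hLHB`, `DHbB = 𝒟H̲·B̄`, `divBc = 𝒟·B̄`; l.37174–37177) with `𝒟H̲·B̄ ↦ −H̲(H̲·B̄)` (`hDHbB`,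
remainder `gH`; l.37176–37178); `ℬ = 𝒟·B̄ + 2H̲·B̄` (`hdiv`, Definition D.8.1).  Conclusion: the display
`+` the bracket `RL = 4tr X(H̲·B̄)𝒜₂ + 4tr X gH⊗̂H̲ + 4(H̲·B̄)gx⊗̂H̲`.
[cite: GiorgiKlainermanSzeftel2024, p0916 L92 – p0917 L7; GiorgiKlainermanSzeftel2022, l.37170–37181] -/
theorem D88_line2 [CharZero K] (Dc : Derivation ℤ K M₁) (hot : M₁ →ₗ[K] M₁ →ₗ[K] M₂)
    (Dhat : M₁ →+ M₂) (x bb HbBc divBc : K) (Hb DHbB gx gH : M₁) (A2 : M₂)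
    (hDL : ∀ (f : K) (u : M₁), Dhat (f • u) = f • Dhat u + hot (Dc f) u)
    (hDx : Dc x = -((2 * x) • Hb) + gx) (hA2 : Dhat Hb = -(hot Hb Hb) + A2)
    (hLHB : Dc HbBc = DHbB + divBc • Hb) (hDHbB : DHbB = -(HbBc • Hb) + gH)
    (hdiv : divBc = bb - 2 * HbBc) :
    (4 : K) • (Dhat ((x * HbBc) • Hb) + (11 : K) • hot Hb ((x * HbBc) • Hb))
        - (20 * x * HbBc) • hot Hb Hb
      = (4 * x * bb) • hot Hb Hb
        + ((4 * x * HbBc) • A2 + (4 * x) • hot gH Hb + (4 * HbBc) • hot gx Hb) := by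
  subst hDHbB hdiv
  simp only [map_add, map_neg, map_smul, hDL, Dc.leibniz, hDx, hA2, hLHB,
    LinearMap.add_apply, LinearMap.neg_apply, LinearMap.smul_apply, smul_add, smul_neg]
  module

/-- Lemma D.8.8, display 6 and the statement (`[J]` p0915 L5–42, p0917 L8–49 = `[v1]` l.37118–37129,
l.37183–37193): "We finally obtain `ᶜ∇₄ℌ₁ + (7/2)tr X ℌ₁ = −(3/2)P[𝒟⊗̂(𝒟𝒟·Ξ̄ − 2H̲𝒟·Ξ̄) −
3H̲⊗̂(𝒟𝒟·Ξ̄ − 2H̲𝒟·Ξ̄)] − (3/2)P(11H̲)⊗̂[…] − 3P·10(H̲⊗̂H̲)𝒟·Ξ̄ + (3/2)P·3tr X H̲⊗̂[H̄·X̂ − conj(tr X̲)Ξ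
+ 𝒜₃] + Expr₂(A) = (3/2)P[−𝒟⊗̂(𝒟𝒟·Ξ̄) − 6H̲⊗̂𝒟𝒟·Ξ̄ − 6(H̲⊗̂H̲)𝒟·Ξ̄ − 3tr X conj(tr X̲)H̲⊗̂Ξ + 3tr X
H̲⊗̂(H̄·X̂) + 3tr X H̲⊗̂𝒜₃] + Expr₂(A)` as stated."  Entering: display 4 (`hR`) with its second line
replaced through display 5 (`hL`, bracket `RL`); the Leibniz rule of `𝒟⊗̂` (`hDL`); the background
"`𝒟P = −3PH̲ + O(ε)`" used silently at l.37186–37187 (`hDP`, remainder `gP`); "`𝒟⊗̂H̲ = −H̲⊗̂H̲`" as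
the definition of `𝒜₂` (`hA2`); one silent symmetry instance (`hs2`).  Conclusion: the printed
statement `+ (RA + RL + RP)`, `RP = −(3/2)gP⊗̂𝒟𝒟·Ξ̄ + 3P(𝒟·Ξ̄)𝒜₂ + 3(𝒟·Ξ̄)gP⊗̂H̲`.
[cite: GiorgiKlainermanSzeftel2024, p0915 L5–42, p0917 L8–49; GiorgiKlainermanSzeftel2022, l.37118–37129, l.37183–37193] -/
theorem D88_final_of [CharZero K] (Dc : Derivation ℤ K M₁) (hot : M₁ →ₗ[K] M₁ →ₗ[K] M₂)
    (Dhat : M₁ →+ M₂) (x p bb HbBc d xbc : K) (Hb A3 U Xi gP : M₁) (E2 L RA RL A2 : M₂)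
    (hDL : ∀ (f : K) (u : M₁), Dhat (f • u) = f • Dhat u + hot (Dc f) u)
    (hR : L = -((4 * x * bb) • hot Hb Hb)
      + (4 : K) • (Dhat ((x * HbBc) • Hb) + (11 : K) • hot Hb ((x * HbBc) • Hb))
      - (20 * x * HbBc) • hot Hb Hb
      - (3 / 2 : K) • (Dhat (p • Dc d - (2 * p * d) • Hb) + (11 : K) • hot Hb (p • Dc d - (2 * p * d) • Hb))
      - (30 * p * d) • hot Hb Hb
      + (3 / 2 * p * (3 * x)) • hot Hb (U - xbc • Xi + A3) + E2 + RA)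
    (hL : (4 : K) • (Dhat ((x * HbBc) • Hb) + (11 : K) • hot Hb ((x * HbBc) • Hb))
        - (20 * x * HbBc) • hot Hb Hb = (4 * x * bb) • hot Hb Hb + RL)
    (hDP : Dc p = -((3 * p) • Hb) + gP) (hA2 : Dhat Hb = -(hot Hb Hb) + A2)
    (hs2 : hot (Dc d) Hb = hot Hb (Dc d)) :
    L = (3 / 2 * p) • (-(Dhat (Dc d)) - (6 : K) • hot Hb (Dc d) - (6 * d) • hot Hb Hb
          - (3 * x * xbc) • hot Hb Xi + (3 * x) • hot Hb U + (3 * x) • hot Hb A3) + E2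
        + (RA + RL + (-((3 / 2 : K) • hot gP (Dc d)) + (3 * p * d) • A2 + (3 * d) • hot gP Hb)) := by
  obtain ⟨h2, -, -, -, -, -, -⟩ := Dm_num Dc
  have hL' := sub_eq_iff_eq_add.mp hL
  subst hR
  rw [hL']
  simp only [map_add, map_sub, map_neg, map_smul, hDL, Dc.leibniz, hDP, hA2, h2, hs2,
    LinearMap.add_apply, LinearMap.neg_apply, LinearMap.smul_apply,
    smul_zero, add_zero, smul_add, smul_sub, smul_neg]
  module

/-- Lemma D.8.8 assembled (`[J]` p0915 L5 – p0917 L49 = `[v1]` l.37118–37194): the printed statement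
"`ᶜ∇₄ℌ₁ + (7/2)tr X ℌ₁ = (3/2)P[−𝒟⊗̂(𝒟𝒟·Ξ̄) − 6H̲⊗̂𝒟𝒟·Ξ̄ − 6(H̲⊗̂H̲)𝒟·Ξ̄ − 3tr X conj(tr X̲)H̲⊗̂Ξ +
3tr X H̲⊗̂(H̄·X̂) + 3tr X H̲⊗̂𝒜₃] + Expr₂(A)`" from the hypotheses of `D88_expand`, `D88_line2` and
`D88_final_of` (display 4, `D88_reorganize`, eliminated), `+` the explicit bracket `RA + RL + RP` of
dropped products.  This is the shape in which the lemma enters `TS_conclusion` (`h88` there, with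
`M8 := −𝒟⊗̂(𝒟𝒟·Ξ̄) − 6H̲⊗̂𝒟𝒟·Ξ̄ − 6(H̲⊗̂H̲)𝒟·Ξ̄ − 3tr X conj(tr X̲)H̲⊗̂Ξ`, `E2 = Expr₂(A)`, `R88 = RA +
RL + RP`).
[cite: GiorgiKlainermanSzeftel2024, p0915 L5 – p0917 L49; GiorgiKlainermanSzeftel2022, l.37118–37194] -/
theorem D88 [CharZero K] {D4 : Derivation ℤ K K} (N4 : CovD D4 M₁) (N4' : CovD D4 M₂)
    (Dc : Derivation ℤ K M₁) (hot : M₁ →ₗ[K] M₁ →ₗ[K] M₂) (Dhat : M₁ →+ M₂)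
    (x p bb HbBc divBc d W' xbc e4x R1 : K) (Hb A1 A3 U Xi Z E' DHbB g4 gx gH gP R2 R82 : M₁)
    (H1 E2 A2 R3 : M₂)
    (hDL : ∀ (f : K) (u : M₁), Dhat (f • u) = f • Dhat u + hot (Dc f) u)
    (hH1 : H1 = -((1 / 2 : K) • Dhat (Dc bb)) - (5 : K) • hot Hb (Dc bb) - (10 * bb) • hot Hb Hb
      + (3 * x) • hot Hb A1)
    (hprodD : N4'.op (hot Hb (Dc bb)) = hot (N4.op Hb) (Dc bb) + hot Hb (N4.op (Dc bb)))
    (hprodHH : N4'.op (hot Hb Hb) = hot (N4.op Hb) Hb + hot Hb (N4.op Hb))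
    (hprodA : N4'.op (hot Hb A1) = hot (N4.op Hb) A1 + hot Hb (N4.op A1))
    (h4Hb : N4.op Hb = -(x • Hb) + g4) (h4x : D4 x = -(1 / 2) * (x * x) + e4x)
    (hiii : N4'.op (Dhat (Dc bb)) = -((7 / 2 * x) • Dhat (Dc bb)) + (8 * x) • hot Hb (Dc bb)
      - (10 * x * bb) • hot Hb Hb + (Dhat Z + hot Hb Z) + (1 / 2 : K) • (Dhat E' + hot Hb E') + R3)
    (hii : N4.op (Dc bb) = -((3 * x) • Dc bb) + (5 * x * bb) • Hb - (8 * x * HbBc) • Hb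
      + (3 * p) • Dc d - (6 * p * d) • Hb + (1 / 2 : K) • E' + R2)
    (hZ : Z = -((8 * x * HbBc) • Hb) + (3 * p) • Dc d - (6 * p * d) • Hb)
    (hi : D4 bb = -(5 / 2 * x * bb) + 2 * x * HbBc + 3 * p * d + 1 / 2 * W' + R1)
    (h82 : N4.op A1 = -((2 * x) • A1) + (1 / 2 : K) • Dc bb + (2 * bb) • Hb
      + (3 / 2 * p) • (U - xbc • Xi + A3) + R82)
    (hE2 : E2 = -((1 / 4 : K) • (Dhat E' + (11 : K) • hot Hb E')) - (5 * W') • hot Hb Hb)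
    (hDx : Dc x = -((2 * x) • Hb) + gx) (hA2 : Dhat Hb = -(hot Hb Hb) + A2)
    (hLHB : Dc HbBc = DHbB + divBc • Hb) (hDHbB : DHbB = -(HbBc • Hb) + gH)
    (hdiv : divBc = bb - 2 * HbBc) (hDP : Dc p = -((3 * p) • Hb) + gP)
    (hs2 : hot (Dc d) Hb = hot Hb (Dc d)) :
    N4'.op H1 + (7 / 2 * x) • H1
      = (3 / 2 * p) • (-(Dhat (Dc d)) - (6 : K) • hot Hb (Dc d) - (6 * d) • hot Hb Hb
          - (3 * x * xbc) • hot Hb Xi + (3 * x) • hot Hb U + (3 * x) • hot Hb A3) + E2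
        + ((-((1 / 2 : K) • R3) - (5 : K) • hot Hb R2 - (5 : K) • hot g4 (Dc bb) - (10 * R1) • hot Hb Hb
            - (10 * bb) • (hot g4 Hb + hot Hb g4) + (3 * x) • hot Hb R82 + (3 * x) • hot g4 A1
            + (3 * e4x) • hot Hb A1)
          + ((4 * x * HbBc) • A2 + (4 * x) • hot gH Hb + (4 * HbBc) • hot gx Hb)
          + (-((3 / 2 : K) • hot gP (Dc d)) + (3 * p * d) • A2 + (3 * d) • hot gP Hb)) := by
  have hA := D88_expand N4 N4' Dc hot Dhat x p bb HbBc d W' xbc e4x R1 Hb A1 A3 U Xi Z E' g4 R2 R82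
    H1 E2 R3 hH1 hprodD hprodHH hprodA h4Hb h4x hiii hii hZ hi h82 hE2
  have hB := D88_reorganize Dc hot Dhat x p bb HbBc d xbc Hb A1 A3 U Xi Z H1 E2 _ _ hDL hH1 hA hZ
  have hC := D88_line2 Dc hot Dhat x bb HbBc divBc Hb DHbB gx gH A2 hDL hDx hA2 hLHB hDHbB hdiv
  exact D88_final_of Dc hot Dhat x p bb HbBc d xbc Hb A3 U Xi gP E2 _ _ _ A2 hDL hB hC hDP hA2 hs2

/-! ## §3 Lemma D.8.9 (`[v1]` Lemma `lemma:nabc4mathfrak2`): `ᶜ∇₄ℌ₂ = I₁ + … + I₅` -/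

/-- Lemma D.8.9, the term `I₁ = ᶜ∇₄𝒜₄` (`[J]` p0918 L39 – p0919 L7 = `[v1]` l.37240–37260).  Entering:
"Using Lemma D.8.4" — its printed statement in the shape of the sibling module's `D84_final`, i.e.
with the collapse-dependent coefficients `(2c − 1)tr X(H̲·H̲̄)`, `½(tr X − conj tr X)·c(H·H̄)` in place
of the printed `tr X(H̲·H̲̄)`, `½(tr X − conj tr X)(H·H̄)` (`hI1`; `c = 1` is the print; `U = H̄·X̂`,
`Ub = H̲̄·X̂`, `MXi = 𝓜[Ξ]`, `XDb (x•Hb) = X̂·conj𝒟(tr X H̲)`, bracket `Q84`); "Using (2.4.4) to write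
`X̂·conj𝒟(tr X H̲) = X̂(conj𝒟·(tr X H̲))`" (`hrule1`); the displayed expansion "`conj𝒟·(tr X H̲) =
conj𝒟(tr X)·H̲ + tr X conj𝒟·H̲ = (conj tr X − tr X)H̄·H̲ + tr X conj𝒟·H̲ = −tr X H̲̄·H̲ − tr X H̄·H̲ + tr
X conj𝒟·H̲`" (`hLeib`; `hDbx`, `hKc` = the backgrounds `conj𝒟(tr X) = (conj tr X − tr X)H̄`, `conj(tr
X)H̄ = −tr X H̲̄` paired with `H̲`, remainders `r1`, `r2`; l.37246–37252 = p0918 L62–72).  Conclusion: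
the display "we finally obtain" (l.37253–37260) — with the `c`-dependent coefficient `(2c − 2)tr
X(H̲·H̲̄)` of `X̂` (printed: absent, `c = 1`) — `+ (Q84 + (r1 + r2)X̂)`.
[cite: GiorgiKlainermanSzeftel2024, p0918 L39 – p0919 L7; GiorgiKlainermanSzeftel2022, l.37240–37260] -/
theorem D89_I1 (hot : M₁ →ₗ[K] M₁ →ₗ[K] M₂) (Dhat : M₁ →+ M₂) (XDb : M₁ →+ M₂)
    (x xc hh HHc HbHc DbHb DbxHb DbxdHb c r1 r2 : K) (Hb B U Ub A3 : M₁) (I1 A4 Xh MXi Q84 : M₂)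
    (hI1 : I1 = -((2 * x) • A4) - (3 * x) • hot Hb A3 - x • Dhat B + (2 * x) • hot Hb B + MXi
      - (1 / 2 * (xc - x)) • Dhat U + (1 / 2 * x) • Dhat Ub
      - (1 / 2 * (x - xc) * (c * HHc)) • Xh + ((2 * c - 1) * x * hh) • Xh
      + x • hot Hb U + XDb (x • Hb) + Q84)
    (hrule1 : XDb (x • Hb) = DbxHb • Xh) (hLeib : DbxHb = DbxdHb + x * DbHb)
    (hDbx : DbxdHb = (xc - x) * HbHc + r1) (hKc : xc * HbHc = -(x * hh) + r2) :
    I1 = -((2 * x) • A4) - (3 * x) • hot Hb A3 - x • Dhat B + (2 * x) • hot Hb B + MXi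
      - (1 / 2 * (xc - x)) • Dhat U + (1 / 2 * x) • Dhat Ub
      - (1 / 2 * (x - xc) * (c * HHc)) • Xh + x • hot Hb U
      + ((2 * c - 2) * x * hh - x * HbHc + x * DbHb) • Xh + (Q84 + (r1 + r2) • Xh) := by
  have hk : DbxHb = -(x * hh) + r2 - x * HbHc + r1 + x * DbHb := by
    rw [hLeib, hDbx]; linear_combination hKc
  subst hI1
  rw [hrule1, hk]
  module

/-- `I₁` with Lemma D.8.4 entering BY NAME: the hypothesis `hI1` of `D89_I1` discharged by the sibling
module's certified `D84_final` (its hypotheses `hN … hM` verbatim, `U = X̂·H̄ = Xc Hc`, `Ub = X̂·H̲̄ = Xc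
Hbc`, `Q84 = Qc + Qf + 4H̲⊗̂q0 + (3/2)qA`), so that the collapse parameter `c` carried through Lemma
D.8.9 and `TS_conclusion` below is literally the `c` of the kernel-certified Lemma D.8.4 (`hcol1`,
`hcol2` there).  "Using Lemma D.8.4 … we finally obtain" (`[J]` p0918 L39 – p0919 L7 = `[v1]`
l.37240–37260).
[cite: GiorgiKlainermanSzeftel2024, p0901 L111–135, p0918 L39 – p0919 L7; GiorgiKlainermanSzeftel2022, l.36661–36668, l.37240–37260] -/
theorem D89_I1_of_D84 [CharZero K] (hot : M₁ →ₗ[K] M₁ →ₗ[K] M₂) (Dhat : M₁ →+ M₂)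
    (Xc : M₁ →ₗ[K] M₁) (XDb : M₁ →+ M₂) (n3 : M₁ →+ M₁)
    (x xc xb r s hh HHc HbHc DbHb DbxHb DbxdHb c r1 r2 : K)
    (F Hb H Hc Hbc Xi B DD4x Dcr C0 n4Hb A3 q0 : M₁) (N A4 Xh Qc Qf qA MXi : M₂)
    (hN : N = Dhat DD4x + Dhat C0 + (4 : K) • hot Hb C0 - (1 / 2 * x) • Dhat F + (4 : K) • hot Hb DD4x
      + (3 : K) • hot n4Hb F + (4 * x) • hot B Hb - (2 : K) • hot Xi (n3 (x • Hb) - (x * xb) • Hb)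
      + XDb (x • Hb) - ((1 + c) * x * hh) • Xh + Qc)
    (hDD1 : DD4x = -(x • F) + Dcr) (hDD2 : Dhat DD4x = -(x • Dhat F) - hot F F + Dhat Dcr)
    (hf : Dhat C0 = -((1 / 2 * x) • Dhat F) - (1 / 2 : K) • hot F F - x • Dhat B + (2 * x) • hot Hb B
      - (1 / 2 * (xc - x)) • Dhat (Xc Hc) + (1 / 2 * x) • Dhat (Xc Hbc)
      - (1 / 2 : K) • hot ((x - xc) • H + (2 * x) • Hb) (Xc Hc) - x • hot Hb (Xc Hbc)
      + (Dhat (r • Hb) + Dhat (s • Xi)) + Qf)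
    (hC0 : C0 = -((1 / 2 * x) • F) - x • B + r • Hb + s • Xi + x • Xc Hbc + (1 / 2 * x) • Xc Hc + q0)
    (hA4 : A4 = Dhat F + (3 : K) • hot Hb F) (hA3 : A3 = (2 : K) • n4Hb - F)
    (hA3F : hot A3 F = -((2 * x) • hot Hb A3) + qA)
    (hcol1 : hot Hb (Xc Hbc) = (c * hh) • Xh) (hcol2 : hot H (Xc Hc) = (c * HHc) • Xh)
    (hsB : hot B Hb = hot Hb B)
    (hM : MXi = Dhat Dcr + (4 : K) • hot Hb Dcr + Dhat (r • Hb) + Dhat (s • Xi) + (4 * r) • hot Hb Hb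
      + (4 * s) • hot Hb Xi - (2 : K) • hot Xi (n3 (x • Hb) - (x * xb) • Hb))
    (hrule1 : XDb (x • Hb) = DbxHb • Xh) (hLeib : DbxHb = DbxdHb + x * DbHb)
    (hDbx : DbxdHb = (xc - x) * HbHc + r1) (hKc : xc * HbHc = -(x * hh) + r2) :
    N = -((2 * x) • A4) - (3 * x) • hot Hb A3 - x • Dhat B + (2 * x) • hot Hb B + MXi
      - (1 / 2 * (xc - x)) • Dhat (Xc Hc) + (1 / 2 * x) • Dhat (Xc Hbc)
      - (1 / 2 * (x - xc) * (c * HHc)) • Xh + x • hot Hb (Xc Hc)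
      + ((2 * c - 2) * x * hh - x * HbHc + x * DbHb) • Xh
      + ((Qc + Qf + (4 : K) • hot Hb q0 + (3 / 2 : K) • qA) + (r1 + r2) • Xh) :=
  D89_I1 hot Dhat XDb x xc hh HHc HbHc DbHb DbxHb DbxdHb c r1 r2 Hb B (Xc Hc) (Xc Hbc) A3 N A4 Xh MXi
    (Qc + Qf + (4 : K) • hot Hb q0 + (3 / 2 : K) • qA)
    (D84_final hot Dhat Xc XDb n3 x xc xb r s hh HHc c F Hb H Hc Hbc Xi B DD4x Dcr C0 n4Hb A3 q0 N A4
      Xh Qc Qf qA MXi hN hDD1 hDD2 hf hC0 hA4 hA3 hA3F hcol1 hcol2 hsB hM)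
    hrule1 hLeib hDbx hKc

/-- Lemma D.8.9, the term `I₂ = −2ᶜ∇₄(B⊗̂H̲)` (`[J]` p0919 L8–22 = `[v1]` l.37262–37268): "`I₂ =
−2ᶜ∇₄B⊗̂H̲ − 2B⊗̂ᶜ∇₄H̲ = −2(−2conj(tr X)B + 3P̄Ξ + ½conj𝒟·A + ½A·H̲̄)⊗̂H̲ + 2tr X B⊗̂H̲ = (2tr X +
4conj tr X)H̲⊗̂B − 6P̄ Ξ⊗̂H̲ − H̲⊗̂(conj𝒟·A + A·H̲̄)`, where we used `ᶜ∇₄H̲ = −tr X H̲ + O(ε)` and the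
Bianchi identity `ᶜ∇₄B = −2conj(tr X)B + 3P̄Ξ + ½conj𝒟·A + ½A·H̲̄`."  Entering: `hI2`, the product rule
(`hprod`), the Bianchi identity as displayed with `WA := conj𝒟·A + A·H̲̄` whole (`hBianchi`), the
background `h4Hb` (remainder `g4`), two silent symmetry instances (`hsB`, `hsW`).  Conclusion: the
display (its "`−6P̄Ξ`" read `−6P̄ Ξ⊗̂H̲`) `+ (−2B⊗̂g4)`.
[cite: GiorgiKlainermanSzeftel2024, p0919 L8–22; GiorgiKlainermanSzeftel2022, l.37262–37268] -/
theorem D89_I2 [CharZero K] {D4 : Derivation ℤ K K} (N4 : CovD D4 M₁) (N4' : CovD D4 M₂)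
    (hot : M₁ →ₗ[K] M₁ →ₗ[K] M₂) (x xc pc : K) (Hb B Xi WA g4 : M₁) (I2 : M₂)
    (hI2 : I2 = -((2 : K) • N4'.op (hot B Hb)))
    (hprod : N4'.op (hot B Hb) = hot (N4.op B) Hb + hot B (N4.op Hb))
    (hBianchi : N4.op B = -((2 * xc) • B) + (3 * pc) • Xi + (1 / 2 : K) • WA)
    (h4Hb : N4.op Hb = -(x • Hb) + g4) (hsB : hot B Hb = hot Hb B) (hsW : hot WA Hb = hot Hb WA) :
    I2 = (2 * x + 4 * xc) • hot Hb B - (6 * pc) • hot Xi Hb - hot Hb WA + (-((2 : K) • hot B g4)) := by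
  subst hI2
  rw [hprod, hBianchi, h4Hb]
  simp only [map_add, map_neg, map_smul, LinearMap.add_apply, LinearMap.smul_apply,
    LinearMap.neg_apply, hsB, hsW, smul_add, smul_neg]
  module

/-- Lemma D.8.9, the auxiliary display inside `I₃` (`[J]` p0919 L36 – p0920 L4 = `[v1]` l.37284–37296):
"Using `ᶜ∇₄H̄ = −½tr X(H̄ − H̲̄) + O(ε)` and the Ricci identity `ᶜ∇₄X̂ = −½(tr X + conj tr X)X̂ + 𝒟⊗̂Ξ
+ Ξ⊗̂(H̲ + H) − A`, we obtain `H̄·ᶜ∇₄X̂ + ᶜ∇₄H̄·X̂ = −½(2tr X + conj tr X)H̄·X̂ + ½tr X H̲̄·X̂ + H̄·𝒟⊗̂Ξ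
+ H̄·(Ξ⊗̂(H̲ + H)) − H̄·A`.  Writing that `conj(tr X)H̄ = −tr X H̲̄ + O(ε)`, we obtain `… = −tr X H̄·X̂
+ tr X H̲̄·X̂ + H̄·𝒟⊗̂Ξ + H̄·(Ξ⊗̂(H̲ + H)) − H̄·A`."  Entering: the product rule for `ᶜ∇₄(H̄·X̂)`
(`hprodU`, `dotT F V = F·V`), the two backgrounds (`h4Hc`, `hK`, remainders `gHc`, `UK`) and the
Ricci identity (`hRic`).  Conclusion: both displayed forms of `ᶜ∇₄(H̄·X̂)`, each `+` its dropped
products (`gHc·X̂`, resp. `gHc·X̂ − ½UK`).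
[cite: GiorgiKlainermanSzeftel2024, p0919 L36 – p0920 L4; GiorgiKlainermanSzeftel2022, l.37284–37296] -/
theorem D89_Z3 [CharZero K] {D4 : Derivation ℤ K K} (N4 : CovD D4 M₁) (N4' : CovD D4 M₂)
    (hot : M₁ →ₗ[K] M₁ →ₗ[K] M₂) (Dhat : M₁ →+ M₂) (dotT : M₁ →ₗ[K] M₂ →ₗ[K] M₁)
    (x xc : K) (Hb H Hc Hbc Xi gHc UK : M₁) (Xh A : M₂)
    (hprodU : N4.op (dotT Hc Xh) = dotT Hc (N4'.op Xh) + dotT (N4.op Hc) Xh)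
    (h4Hc : N4.op Hc = -((1 / 2 * x) • (Hc - Hbc)) + gHc)
    (hRic : N4'.op Xh = -((1 / 2 * (x + xc)) • Xh) + Dhat Xi + hot Xi (Hb + H) - A)
    (hK : xc • dotT Hc Xh = -(x • dotT Hbc Xh) + UK) :
    N4.op (dotT Hc Xh) = -((1 / 2 * (2 * x + xc)) • dotT Hc Xh) + (1 / 2 * x) • dotT Hbc Xh
        + dotT Hc (Dhat Xi + hot Xi (Hb + H)) - dotT Hc A + dotT gHc Xh ∧
      N4.op (dotT Hc Xh) = -(x • dotT Hc Xh) + x • dotT Hbc Xh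
        + dotT Hc (Dhat Xi + hot Xi (Hb + H)) - dotT Hc A + (dotT gHc Xh - (1 / 2 : K) • UK) := by
  rw [hprodU, h4Hc, hRic]
  simp only [map_add, map_sub, map_neg, map_smul, LinearMap.add_apply, LinearMap.sub_apply,
    LinearMap.smul_apply, LinearMap.neg_apply, smul_sub]
  constructor
  · module
  · linear_combination (norm := module) (-(1 / 2 : K)) • hK

/-- Lemma D.8.9, the term `I₃ = −ᶜ∇₄𝒟⊗̂(H̄·X̂)` (`[J]` p0919 L23 – p0920 L72 = `[v1]` l.37271–37313).
Entering: `hI3` (`U = H̄·X̂`); "Using Lemma 4.2.2, (4.2.13), applied to `F = H̄·X̂` and `s = 1`: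
`[ᶜ∇₄, 𝒟⊗̂]H̄·X̂ = −½tr X 𝒟⊗̂(H̄·X̂) + H̲⊗̂ᶜ∇₄(H̄·X̂)`" in the err form (`hcomm`, remainder `g₁₃`;
p0919 L24 = l.37273–37276); the two displayed forms of `ᶜ∇₄(H̄·X̂)` from `D89_Z3` (`hZ`, `hZ3`, `hZ3'`;
`Ub = H̲̄·X̂`, `HcRX = H̄·(𝒟⊗̂Ξ + Ξ⊗̂(H̲ + H))`, `HcA = H̄·A`, brackets `qZ`, `qZ'`) — the text inserts
the first under `𝒟⊗̂` and the second under `H̲⊗̂` (l.37297–37300); the Leibniz rule of `𝒟⊗̂` (`hDL`);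
"Using that `𝒟tr X = −2tr X H̲ + O(ε)` and `𝒟(conj tr X) = (tr X − conj tr X)H + O(ε)`" (`hDx`, `hDxc`,
remainders `gx`, `gxc`; l.37305 = p0920 L50); and the COLLAPSE "`½(tr X − conj tr X)H⊗̂(H̄·X̂) = ½(tr
X − conj tr X)(H·H̄)X̂`" carried with the free factor `c` (`hcolH : H⊗̂(H̄·X̂) = c(H·H̄)X̂`; printed `c
= 1`, `[J]` (2.4.3) gives `2` — see the module docstring, PRINT DATUM).  Conclusion: the display
"we obtain `I₃ = ½(3tr X + conj tr X)𝒟⊗̂(H̄·X̂) − ½tr X 𝒟⊗̂(H̲̄·X̂) − tr X H̲⊗̂(H̄·X̂) + ½(tr X − conj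
tr X)(H·H̄)X̂ + 𝒟⊗̂(H̄·A) + H̲⊗̂H̄·A`" (l.37307–37312, the `Ξ`-terms `−(𝒟⊗̂ + H̲⊗̂)(H̄·(𝒟⊗̂Ξ + Ξ⊗̂(H̲ +
H)))` that the text moves to `𝓜̃[Ξ]` kept explicit) with `c(H·H̄)` for `(H·H̄)`, `+` the bracket of
dropped products.
[cite: GiorgiKlainermanSzeftel2024, p0919 L23 – p0920 L72; GiorgiKlainermanSzeftel2022, l.37271–37313] -/
theorem D89_I3 [CharZero K] {D4 : Derivation ℤ K K} (N4 : CovD D4 M₁) (N4' : CovD D4 M₂)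
    (Dc : Derivation ℤ K M₁) (hot : M₁ →ₗ[K] M₁ →ₗ[K] M₂) (Dhat : M₁ →+ M₂)
    (x xc HHc c : K) (Hb H U Ub HcRX HcA gx gxc qZ qZ' Z3 : M₁) (I3 Xh g₁₃ : M₂)
    (hDL : ∀ (f : K) (u : M₁), Dhat (f • u) = f • Dhat u + hot (Dc f) u)
    (hI3 : I3 = -(N4'.op (Dhat U)))
    (hcomm : N4'.op (Dhat U) = Dhat (N4.op U) - (1 / 2 * x) • Dhat U + hot Hb (N4.op U) + g₁₃)
    (hZ : N4.op U = Z3)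
    (hZ3 : Z3 = -((1 / 2 * (2 * x + xc)) • U) + (1 / 2 * x) • Ub + HcRX - HcA + qZ)
    (hZ3' : Z3 = -(x • U) + x • Ub + HcRX - HcA + qZ')
    (hDx : Dc x = -((2 * x) • Hb) + gx) (hDxc : Dc xc = (x - xc) • H + gxc)
    (hcolH : hot H U = (c * HHc) • Xh) :
    I3 = (1 / 2 * (3 * x + xc)) • Dhat U - (1 / 2 * x) • Dhat Ub - x • hot Hb U
      + (1 / 2 * (x - xc) * (c * HHc)) • Xh + Dhat HcA + hot Hb HcA
      - (Dhat HcRX + hot Hb HcRX)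
      + (-g₁₃ - Dhat qZ - hot Hb qZ' + hot (gx + (1 / 2 : K) • gxc) U - (1 / 2 : K) • hot gx Ub) := by
  obtain ⟨h2, -, -, -, h12, -, -⟩ := Dm_num Dc
  subst hI3
  rw [hcomm, hZ, show Dhat Z3 = Dhat (-((1 / 2 * (2 * x + xc)) • U) + (1 / 2 * x) • Ub + HcRX - HcA
    + qZ) by rw [← hZ3], show hot Hb Z3 = hot Hb (-(x • U) + x • Ub + HcRX - HcA + qZ') by rw [← hZ3']]
  simp only [map_add, map_sub, map_neg, map_smul, hDL, Dc.leibniz, h2, h12, hDx, hDxc,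
    LinearMap.add_apply, LinearMap.smul_apply, LinearMap.neg_apply, hcolH,
    smul_zero, add_zero, smul_add, smul_neg]
  module

/-- Lemma D.8.9, the term `I₄ = ᶜ∇₄((conj(tr X tr X̲) − 2conj𝒟·H̲ − 2P)X̂)` (`[J]` p0920 L73 – p0921
L47 = `[v1]` l.37315–37353).  Entering: `hI4`, `hs2` (`s2 = conj(tr X tr X̲) − 2conj𝒟·H̲ − 2P`, the
first product carried as `xc·xbc`); the Ricci identity for `ᶜ∇₄X̂` (`hRic`); "where we used `ᶜ∇₄conj
tr X = −½(conj tr X)² + O(ε)`, `ᶜ∇₄conj(tr X̲) = −½conj(tr X tr X̲) + conj𝒟·H̲ + H̲·H̲̄ + 2P +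
O(ε²)`, `ᶜ∇₄P = −(3/2)tr X P + O(ε)`" (`h4xc`, `hn4xbc`, `h4P`, remainders `e4xc`, `exbc`, `e4P`;
l.37325 = p0920 L117); "Finally, using Lemma 4.2.2, (4.2.16), applied to `F = H̲` and `s = 0`,
`[ᶜ∇₄, conj𝒟·]H̲ = −½conj(tr X)(conj𝒟·H̲ − H̲̄·H̲) + H̲̄·ᶜ∇₄H̲ + O(ε) = … − tr X H̲̄·H̲ + O(ε)`, we write
`−2ᶜ∇₄conj𝒟·H̲ = −2conj𝒟·(ᶜ∇₄H̲) − 2[ᶜ∇₄, conj𝒟·]H̲ = 2conj𝒟·(tr X H̲) + … = −2tr X H̄·H̲ + (2tr X + conj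
tr X)conj𝒟·H̲ − conj(tr X)H̲̄·H̲`" (l.37332–37347 = p0921 L5–33): `hN4Db` (`ᶜ∇₄conj𝒟·H̲ = conj𝒟·ᶜ∇₄H̲ +
[ᶜ∇₄, conj𝒟·]H̲`), `hCm` (the commutator as displayed, `HbcN4Hb = H̲̄·ᶜ∇₄H̲`, remainder `eC`), `hHbcN4`
(`H̲̄·ᶜ∇₄H̲ = −tr X H̲̄·H̲ + r4`), `hDbN4` (`conj𝒟·ᶜ∇₄H̲ = −conj𝒟·(tr X H̲) + r5`), and the expansion of
`conj𝒟·(tr X H̲)` exactly as in `I₁` (`hLeib`, `hDbx`, `hKc`, remainders `r1`, `r2`).  Conclusion: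
"We finally obtain `I₄ = [−½(tr X + 3conj tr X)conj(tr X tr X̲) + (3tr X + 3conj tr X)conj𝒟·H̲ − 2tr X
H̄·H̲ + (4tr X + 3conj tr X)P]X̂ + (s2)(𝒟⊗̂Ξ + Ξ⊗̂(H̲ + H)) − (s2)A`" (l.37349–37352) `+` the scalar
bracket of dropped products times `X̂`.
[cite: GiorgiKlainermanSzeftel2024, p0920 L73 – p0921 L47; GiorgiKlainermanSzeftel2022, l.37315–37353] -/
theorem D89_I4 [CharZero K] {D4 : Derivation ℤ K K} (N4' : CovD D4 M₂)
    (hot : M₁ →ₗ[K] M₁ →ₗ[K] M₂) (Dhat : M₁ →+ M₂)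
    (x xc xbc p hh HbHc DbHb DbxHb DbxdHb DbN4Hb Cm HbcN4Hb s2 e4xc exbc e4P eC r1 r2 r4 r5 : K)
    (Hb H Xi : M₁) (I4 Xh A : M₂)
    (hI4 : I4 = N4'.op (s2 • Xh)) (hs2 : s2 = xc * xbc - 2 * DbHb - 2 * p)
    (hRic : N4'.op Xh = -((1 / 2 * (x + xc)) • Xh) + Dhat Xi + hot Xi (Hb + H) - A)
    (h4xc : D4 xc = -(1 / 2) * (xc * xc) + e4xc)
    (hn4xbc : D4 xbc = -(1 / 2) * (xc * xbc) + DbHb + hh + 2 * p + exbc)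
    (h4P : D4 p = -(3 / 2) * (x * p) + e4P)
    (hN4Db : D4 DbHb = DbN4Hb + Cm)
    (hCm : Cm = -(1 / 2) * (xc * (DbHb - hh)) + HbcN4Hb + eC) (hHbcN4 : HbcN4Hb = -(x * hh) + r4)
    (hDbN4 : DbN4Hb = -DbxHb + r5) (hLeib : DbxHb = DbxdHb + x * DbHb)
    (hDbx : DbxdHb = (xc - x) * HbHc + r1) (hKc : xc * HbHc = -(x * hh) + r2) :
    I4 = (-(1 / 2) * ((x + 3 * xc) * (xc * xbc)) + (3 * x + 3 * xc) * DbHb - 2 * x * HbHc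
        + (4 * x + 3 * xc) * p) • Xh
      + s2 • (Dhat Xi + hot Xi (Hb + H)) - s2 • A
      + (e4xc * xbc + xc * exbc - 2 * e4P + 2 * r1 + 2 * r2 - 2 * r4 - 2 * r5 - 2 * eC) • Xh := by
  obtain ⟨h2, -, -, -, -, -, -⟩ := Dm_num D4
  have hk : D4 DbHb = x * hh - r2 + x * HbHc - r1 - x * DbHb + r5
      + (-(1 / 2) * (xc * (DbHb - hh)) + (-(x * hh) + r4) + eC) := by
    rw [hN4Db, hCm, hHbcN4, hDbN4, hLeib, hDbx]; linear_combination -hKc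
  subst hI4 hs2
  rw [N4'.leibniz, hRic]
  simp only [map_sub, D4.leibniz, h2, h4xc, hn4xbc, h4P, hk, smul_eq_mul, mul_zero,
    add_zero, smul_add, smul_sub, smul_neg]
  module

/-- Lemma D.8.9, the term `I₅ = −3ᶜ∇₄(H̲⊗̂(H̄·X̂))` (`[J]` p0921 L48 – p0922 L12 = `[v1]` l.37356–37366):
"`I₅ = −3ᶜ∇₄H̲⊗̂(H̄·X̂) − 3H̲⊗̂(ᶜ∇₄H̄·X̂) − 3H̲⊗̂(H̄·ᶜ∇₄X̂) = 3tr X H̲⊗̂(H̄·X̂) + (3/2)tr X H̲⊗̂((H̄ −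
H̲̄)·X̂) − 3H̲⊗̂(H̄·(−½(tr X + conj tr X)X̂ + 𝒟⊗̂Ξ + Ξ⊗̂(H̲ + H) − A)) = 6tr X H̲⊗̂(H̄·X̂) − (3/2)tr
X(H̲·H̲̄)X̂ + (3/2)conj(tr X)H̲⊗̂(H̄·X̂) − … = 6tr X H̲⊗̂(H̄·X̂) − 3tr X(H̲·H̲̄)X̂ − 3H̲⊗̂(H̄·(𝒟⊗̂Ξ + Ξ⊗̂(H̲
+ H))) + 3H̲⊗̂(H̄·A)`."  Entering: `hI5`, the product rule (`hprod`), the background `h4Hb` (remainder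
`g4`), the first form of `ᶜ∇₄(H̄·X̂)` from `D89_Z3` (`hZ`, `hZ3`, bracket `qZ`), the background `conj(tr
X)H̄·X̂ = −tr X H̲̄·X̂ + O(ε)` (`hK`, remainder `UK`) and the COLLAPSE "`H̲⊗̂(H̲̄·X̂) = (H̲·H̲̄)X̂`" with the
free factor `c` (`hcolb`; printed `c = 1`).  Conclusion: the final display with `−3c·tr X(H̲·H̲̄)` for
the printed `−3tr X(H̲·H̲̄)`, `+` the bracket of dropped products.
[cite: GiorgiKlainermanSzeftel2024, p0921 L48 – p0922 L12; GiorgiKlainermanSzeftel2022, l.37356–37366] -/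
theorem D89_I5 [CharZero K] {D4 : Derivation ℤ K K} (N4 : CovD D4 M₁) (N4' : CovD D4 M₂)
    (hot : M₁ →ₗ[K] M₁ →ₗ[K] M₂) (x xc hh c : K) (Hb U Ub HcRX HcA g4 qZ UK Z3 : M₁) (I5 Xh : M₂)
    (hI5 : I5 = -((3 : K) • N4'.op (hot Hb U)))
    (hprod : N4'.op (hot Hb U) = hot (N4.op Hb) U + hot Hb (N4.op U))
    (h4Hb : N4.op Hb = -(x • Hb) + g4) (hZ : N4.op U = Z3)
    (hZ3 : Z3 = -((1 / 2 * (2 * x + xc)) • U) + (1 / 2 * x) • Ub + HcRX - HcA + qZ)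
    (hcolb : hot Hb Ub = (c * hh) • Xh) (hK : xc • U = -(x • Ub) + UK) :
    I5 = (6 * x) • hot Hb U - (3 * c * (x * hh)) • Xh - (3 : K) • hot Hb HcRX + (3 : K) • hot Hb HcA
      + (-((3 : K) • hot g4 U) - (3 : K) • hot Hb qZ + (3 / 2 : K) • hot Hb UK) := by
  have hK' := congrArg (hot Hb) hK
  simp only [map_add, map_neg, map_smul, hcolb] at hK'
  subst hI5
  rw [hprod, h4Hb, hZ, hZ3]
  simp only [map_add, map_sub, map_neg, map_smul, LinearMap.add_apply,
    LinearMap.smul_apply, LinearMap.neg_apply, hcolb, smul_add, smul_sub, smul_neg]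
  linear_combination (norm := module) (3 / 2 : K) • hK'


/-- Lemma D.8.9, the splitting (`[J]` p0918 L5–38 = `[v1]` l.37221–37236): "Recall that `ℌ₂ = 𝒜₄ −
2B⊗̂H̲ − 𝒟⊗̂(H̄·X̂) + (conj(tr X tr X̲) − 2conj𝒟·H̲ − 2P)X̂ − 3H̲⊗̂(H̄·X̂)`.  We therefore obtain `ᶜ∇₄ℌ₂
= I₁ + I₂ + I₃ + I₄ + I₅` with `I₁ = ᶜ∇₄𝒜₄`, `I₂ = −2ᶜ∇₄(B⊗̂H̲)`, `I₃ = −∇₄𝒟⊗̂(H̄·X̂)`, `I₄ =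
ᶜ∇₄((conj(tr X tr X̲) − 2conj𝒟·H̲ − 2P)X̂)`, `I₅ = −3ᶜ∇₄(H̲⊗̂(H̄·X̂))`."  EXACT (additivity of `ᶜ∇₄`).
[cite: GiorgiKlainermanSzeftel2024, p0918 L5–38; GiorgiKlainermanSzeftel2022, l.37221–37236] -/
theorem D89_split [CharZero K] {D4 : Derivation ℤ K K} (N4' : CovD D4 M₂)
    (hot : M₁ →ₗ[K] M₁ →ₗ[K] M₂) (Dhat : M₁ →+ M₂) (s2 : K) (Hb B U : M₁) (H2 A4 Xh : M₂)
    (hH2 : H2 = A4 - (2 : K) • hot B Hb - Dhat U + s2 • Xh - (3 : K) • hot Hb U) :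
    N4'.op H2 = N4'.op A4 + (-((2 : K) • N4'.op (hot B Hb))) + (-(N4'.op (Dhat U)))
      + N4'.op (s2 • Xh) + (-((3 : K) • N4'.op (hot Hb U))) := by
  obtain ⟨h2, h3, -, -, -, -, -⟩ := Dm_num D4
  subst hH2
  rw [map_sub, map_add, map_sub, map_sub, N4'.leibniz 2, N4'.leibniz 3, h2, h3]
  module

/-- Lemma D.8.9, "We obtain for the sum" and "Writing `ℌ₂ = …`, we obtain" (`[J]` p0922 L13–69 =
`[v1]` l.37368–37390).  Entering: the splitting (`hN`), `hH2`, `hs2`, the five terms in the shape of the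
conclusions of `D89_I1` … `D89_I5` (`hI1` … `hI5`, brackets `R1` … `R5`) and one silent symmetry
instance (`hsB`).  Conclusion: the display "`ᶜ∇₄ℌ₂ = −2tr X ℌ₂ − 3tr X H̲⊗̂𝒜₃ − tr X 𝒟⊗̂B + 4conj(tr
X)H̲⊗̂B + [½(3tr X − 3conj tr X)conj(tr X tr X̲) + 3conj(tr X)conj𝒟·H̲ − 3tr X(H̲·H̲̄) − 3tr X H̄·H̲ +
3conj(tr X)P]X̂ + Expr₃(A) + 𝓜̃[Ξ]`" (l.37387–37389) with the `c`-dependent coefficient `−(c + 2)tr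
X(H̲·H̲̄)` for the printed `−3tr X(H̲·H̲̄)`, and with `Expr₃(A) = −H̲⊗̂(conj𝒟·A + A·H̲̄) + 𝒟⊗̂(H̄·A) +
4H̲⊗̂(H̄·A) − (conj(tr X tr X̲) − 2conj𝒟·H̲ − 2P)A` and `𝓜̃[Ξ] = 𝓜[Ξ] − 6P̄ Ξ⊗̂H̲ − (𝒟⊗̂ +
H̲⊗̂)(H̄·(𝒟⊗̂Ξ + Ξ⊗̂(H̲ + H))) + (conj(tr X tr X̲) − 2conj𝒟·H̲ − 2P)(𝒟⊗̂Ξ + Ξ⊗̂(H̲ + H)) − 3H̲⊗̂(H̄·(𝒟⊗̂Ξ +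
Ξ⊗̂(H̲ + H)))` as EXPLICIT sums (the print has `−conj𝒟·H̲` for `−2conj𝒟·H̲` in both and drops the
`⊗̂H̲` of `−6P̄ Ξ⊗̂H̲`, see the module docstring), `+ (R1 + … + R5)`.  The terms `±½(conj tr X − tr
X)𝒟⊗̂(H̄·X̂)`, `±½tr X 𝒟⊗̂(H̲̄·X̂)`, `±½(tr X − conj tr X)c(H·H̄)X̂` of `I₁` and `I₃` cancel as in the
text.
[cite: GiorgiKlainermanSzeftel2024, p0922 L13–69; GiorgiKlainermanSzeftel2022, l.37368–37390] -/
theorem D89_sum [CharZero K] {D4 : Derivation ℤ K K} (N4' : CovD D4 M₂)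
    (hot : M₁ →ₗ[K] M₁ →ₗ[K] M₂) (Dhat : M₁ →+ M₂)
    (x xc xbc p pc hh HHc HbHc DbHb s2 c : K) (Hb H B U Ub Xi A3 WA HcRX HcA : M₁)
    (H2 I1 I2 I3 I4 I5 A4 A Xh MXi R1 R2 R3 R4 R5 : M₂)
    (hH2 : H2 = A4 - (2 : K) • hot B Hb - Dhat U + s2 • Xh - (3 : K) • hot Hb U)
    (hs2 : s2 = xc * xbc - 2 * DbHb - 2 * p)
    (hN : N4'.op H2 = I1 + I2 + I3 + I4 + I5)
    (hI1 : I1 = -((2 * x) • A4) - (3 * x) • hot Hb A3 - x • Dhat B + (2 * x) • hot Hb B + MXi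
      - (1 / 2 * (xc - x)) • Dhat U + (1 / 2 * x) • Dhat Ub
      - (1 / 2 * (x - xc) * (c * HHc)) • Xh + x • hot Hb U
      + ((2 * c - 2) * x * hh - x * HbHc + x * DbHb) • Xh + R1)
    (hI2 : I2 = (2 * x + 4 * xc) • hot Hb B - (6 * pc) • hot Xi Hb - hot Hb WA + R2)
    (hI3 : I3 = (1 / 2 * (3 * x + xc)) • Dhat U - (1 / 2 * x) • Dhat Ub - x • hot Hb U
      + (1 / 2 * (x - xc) * (c * HHc)) • Xh + Dhat HcA + hot Hb HcA
      - (Dhat HcRX + hot Hb HcRX) + R3)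
    (hI4 : I4 = (-(1 / 2) * ((x + 3 * xc) * (xc * xbc)) + (3 * x + 3 * xc) * DbHb - 2 * x * HbHc
        + (4 * x + 3 * xc) * p) • Xh
      + s2 • (Dhat Xi + hot Xi (Hb + H)) - s2 • A + R4)
    (hI5 : I5 = (6 * x) • hot Hb U - (3 * c * (x * hh)) • Xh - (3 : K) • hot Hb HcRX
      + (3 : K) • hot Hb HcA + R5)
    (hsB : hot B Hb = hot Hb B) :
    N4'.op H2 = -((2 * x) • H2) - (3 * x) • hot Hb A3 - x • Dhat B + (4 * xc) • hot Hb B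
      + (1 / 2 * ((3 * x - 3 * xc) * (xc * xbc)) + 3 * xc * DbHb - (c + 2) * x * hh - 3 * x * HbHc
        + 3 * xc * p) • Xh
      + (-(hot Hb WA) + Dhat HcA + (4 : K) • hot Hb HcA - (xc * xbc - 2 * DbHb - 2 * p) • A)
      + (MXi - (6 * pc) • hot Xi Hb - (Dhat HcRX + hot Hb HcRX)
        + (xc * xbc - 2 * DbHb - 2 * p) • (Dhat Xi + hot Xi (Hb + H)) - (3 : K) • hot Hb HcRX)
      + (R1 + R2 + R3 + R4 + R5) := by
  rw [hN]
  subst hI1 hI2 hI3 hI4 hI5 hH2 hs2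
  rw [hsB]
  module

/-- Lemma D.8.9, the `B`-terms and the statement (`[J]` p0917 L51 – p0918 L4, p0922 L70 – p0923 L10 =
`[v1]` l.37200–37210, l.37391–37405): "Observe that `conj(tr X)H̲ = −tr X H + O(ε)` and therefore on
the right hand side the terms depending on `B` can be written in terms of `A` and `X̂` using the
Bianchi identity for `ᶜ∇₃A`, i.e. `−tr X 𝒟⊗̂B + 4conj(tr X)B⊗̂H̲ = −tr X 𝒟⊗̂B − 4tr X B⊗̂H = tr
X(−ᶜ∇₃A − ½tr X̲ A − 3P̄X̂)`.  This gives `ᶜ∇₄ℌ₂ = −2tr X ℌ₂ − 3tr X H̲⊗̂𝒜₃ + […, 3(conj(tr X)P − tr X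
P̄)]X̂ + Expr₄(A) + 𝓜̃[Ξ]` with `Expr₄(A) = Expr₃(A) + tr X(−ᶜ∇₃A − ½tr X̲ A)`."  Entering: the sum
(`hS`, with `E3 = Expr₃(A)`, `MXt = 𝓜̃[Ξ]`, bracket `R0`), the background `hK2` (remainder `gK2`),
the displayed Bianchi step as ONE hypothesis (`hBianchi`, `n3 = ᶜ∇₃`), a silent symmetry instance
(`hsB`).  Conclusion: the statement of Lemma D.8.9 (with `−(c + 2)tr X(H̲·H̲̄)` for `−3tr X(H̲·H̲̄)`),
`+ (R0 + 4B⊗̂gK2)`.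
[cite: GiorgiKlainermanSzeftel2024, p0917 L51 – p0918 L4, p0922 L70 – p0923 L10; GiorgiKlainermanSzeftel2022, l.37200–37210, l.37391–37405] -/
theorem D89_final (hot : M₁ →ₗ[K] M₁ →ₗ[K] M₂) (Dhat : M₁ →+ M₂) (n3 : M₂ →+ M₂)
    (x xc xb xbc p pc hh HbHc DbHb c : K) (Hb H B A3 gK2 : M₁) (N H2 A Xh E3 MXt R0 : M₂)
    (hS : N = -((2 * x) • H2) - (3 * x) • hot Hb A3 - x • Dhat B + (4 * xc) • hot Hb B
      + (1 / 2 * ((3 * x - 3 * xc) * (xc * xbc)) + 3 * xc * DbHb - (c + 2) * x * hh - 3 * x * HbHc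
        + 3 * xc * p) • Xh + E3 + MXt + R0)
    (hK2 : xc • Hb = -(x • H) + gK2) (hsB : hot B Hb = hot Hb B)
    (hBianchi : -(x • Dhat B) - (4 * x) • hot B H = x • (-(n3 A) - (1 / 2 * xb) • A - (3 * pc) • Xh)) :
    N = -((2 * x) • H2) - (3 * x) • hot Hb A3 + MXt
      + (1 / 2 * ((3 * x - 3 * xc) * (xc * xbc)) + 3 * xc * DbHb - (c + 2) * x * hh - 3 * x * HbHc
        + 3 * (xc * p - x * pc)) • Xh
      + (E3 + x • (-(n3 A) - (1 / 2 * xb) • A)) + (R0 + (4 : K) • hot B gK2) := by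
  have hK2' := congrArg (hot B) hK2
  simp only [map_add, map_neg, map_smul, hsB] at hK2'
  linear_combination (norm := module) hS + (4 : K) • hK2' + hBianchi

/-- Lemma D.8.9 assembled (`[J]` p0917 L51 – p0923 L10 = `[v1]` l.37200–37407): the printed statement
"`ᶜ∇₄ℌ₂ = −2tr X ℌ₂ − 3tr X H̲⊗̂𝒜₃ + 𝓜̃[Ξ] + [½(3tr X − 3conj tr X)conj(tr X tr X̲) + 3conj(tr
X)conj𝒟·H̲ − 3tr X(H̲·H̲̄) − 3tr X H̄·H̲ + 3(conj(tr X)P − tr X P̄)]X̂ + Expr₄(A)`" — with the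
collapse-dependent `−(c + 2)tr X(H̲·H̲̄)` for `−3tr X(H̲·H̲̄)` (`c = 1` the print), `𝓜̃[Ξ]` and
`Expr₄(A)` explicit — from the hypotheses of `D89_split`, `D89_I1` … `D89_I5`, `D89_final`, `+` the
explicit bracket of dropped products.  This is the shape in which the lemma enters `TS_conclusion`
(`h89` there: `MXt = 𝓜̃[Ξ]`, `E4 = Expr₄(A)`, `R89` the bracket).
[cite: GiorgiKlainermanSzeftel2024, p0917 L51 – p0923 L10; GiorgiKlainermanSzeftel2022, l.37200–37407] -/
theorem D89 [CharZero K] {D4 : Derivation ℤ K K} (N4 : CovD D4 M₁) (N4' : CovD D4 M₂)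
    (Dc : Derivation ℤ K M₁) (hot : M₁ →ₗ[K] M₁ →ₗ[K] M₂) (Dhat : M₁ →+ M₂) (XDb : M₁ →+ M₂)
    (n3 : M₂ →+ M₂)
    (x xc xb xbc p pc hh HHc HbHc DbHb DbxHb DbxdHb DbN4Hb Cm HbcN4Hb s2 c
      e4xc exbc e4P eC r1 r2 r4 r5 : K)
    (Hb H B U Ub Xi A3 WA HcRX HcA g4 gx gxc qZ qZ' UK Z3 gK2 : M₁)
    (H2 A4 A Xh MXi Q84 g₁₃ : M₂)
    (hDL : ∀ (f : K) (u : M₁), Dhat (f • u) = f • Dhat u + hot (Dc f) u)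
    (hH2 : H2 = A4 - (2 : K) • hot B Hb - Dhat U + s2 • Xh - (3 : K) • hot Hb U)
    (hs2 : s2 = xc * xbc - 2 * DbHb - 2 * p)
    (h84 : N4'.op A4 = -((2 * x) • A4) - (3 * x) • hot Hb A3 - x • Dhat B + (2 * x) • hot Hb B + MXi
      - (1 / 2 * (xc - x)) • Dhat U + (1 / 2 * x) • Dhat Ub
      - (1 / 2 * (x - xc) * (c * HHc)) • Xh + ((2 * c - 1) * x * hh) • Xh
      + x • hot Hb U + XDb (x • Hb) + Q84)
    (hrule1 : XDb (x • Hb) = DbxHb • Xh) (hLeib : DbxHb = DbxdHb + x * DbHb)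
    (hDbx : DbxdHb = (xc - x) * HbHc + r1) (hKc : xc * HbHc = -(x * hh) + r2)
    (hprodB : N4'.op (hot B Hb) = hot (N4.op B) Hb + hot B (N4.op Hb))
    (hBianchiB : N4.op B = -((2 * xc) • B) + (3 * pc) • Xi + (1 / 2 : K) • WA)
    (h4Hb : N4.op Hb = -(x • Hb) + g4) (hsB : hot B Hb = hot Hb B) (hsW : hot WA Hb = hot Hb WA)
    (hcomm : N4'.op (Dhat U) = Dhat (N4.op U) - (1 / 2 * x) • Dhat U + hot Hb (N4.op U) + g₁₃)
    (hZ : N4.op U = Z3)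
    (hZ3 : Z3 = -((1 / 2 * (2 * x + xc)) • U) + (1 / 2 * x) • Ub + HcRX - HcA + qZ)
    (hZ3' : Z3 = -(x • U) + x • Ub + HcRX - HcA + qZ')
    (hDx : Dc x = -((2 * x) • Hb) + gx) (hDxc : Dc xc = (x - xc) • H + gxc)
    (hcolH : hot H U = (c * HHc) • Xh)
    (hRic : N4'.op Xh = -((1 / 2 * (x + xc)) • Xh) + Dhat Xi + hot Xi (Hb + H) - A)
    (h4xc : D4 xc = -(1 / 2) * (xc * xc) + e4xc)
    (hn4xbc : D4 xbc = -(1 / 2) * (xc * xbc) + DbHb + hh + 2 * p + exbc)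
    (h4P : D4 p = -(3 / 2) * (x * p) + e4P)
    (hN4Db : D4 DbHb = DbN4Hb + Cm)
    (hCm : Cm = -(1 / 2) * (xc * (DbHb - hh)) + HbcN4Hb + eC) (hHbcN4 : HbcN4Hb = -(x * hh) + r4)
    (hDbN4 : DbN4Hb = -DbxHb + r5)
    (hprodU : N4'.op (hot Hb U) = hot (N4.op Hb) U + hot Hb (N4.op U))
    (hcolb : hot Hb Ub = (c * hh) • Xh) (hK : xc • U = -(x • Ub) + UK)
    (hK2 : xc • Hb = -(x • H) + gK2)
    (hBianchiA : -(x • Dhat B) - (4 * x) • hot B H = x • (-(n3 A) - (1 / 2 * xb) • A - (3 * pc) • Xh)) :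
    N4'.op H2 = -((2 * x) • H2) - (3 * x) • hot Hb A3
      + (MXi - (6 * pc) • hot Xi Hb - (Dhat HcRX + hot Hb HcRX)
        + (xc * xbc - 2 * DbHb - 2 * p) • (Dhat Xi + hot Xi (Hb + H)) - (3 : K) • hot Hb HcRX)
      + (1 / 2 * ((3 * x - 3 * xc) * (xc * xbc)) + 3 * xc * DbHb - (c + 2) * x * hh - 3 * x * HbHc
        + 3 * (xc * p - x * pc)) • Xh
      + ((-(hot Hb WA) + Dhat HcA + (4 : K) • hot Hb HcA - (xc * xbc - 2 * DbHb - 2 * p) • A)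
        + x • (-(n3 A) - (1 / 2 * xb) • A))
      + (((Q84 + (r1 + r2) • Xh) + (-((2 : K) • hot B g4))
          + (-g₁₃ - Dhat qZ - hot Hb qZ' + hot (gx + (1 / 2 : K) • gxc) U - (1 / 2 : K) • hot gx Ub)
          + (e4xc * xbc + xc * exbc - 2 * e4P + 2 * r1 + 2 * r2 - 2 * r4 - 2 * r5 - 2 * eC) • Xh
          + (-((3 : K) • hot g4 U) - (3 : K) • hot Hb qZ + (3 / 2 : K) • hot Hb UK))
        + (4 : K) • hot B gK2) := by
  have h1 := D89_I1 hot Dhat XDb x xc hh HHc HbHc DbHb DbxHb DbxdHb c r1 r2 Hb B U Ub A3 (N4'.op A4)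
    A4 Xh MXi Q84 h84 hrule1 hLeib hDbx hKc
  have h2 := D89_I2 N4 N4' hot x xc pc Hb B Xi WA g4 _ rfl hprodB hBianchiB h4Hb hsB hsW
  have h3 := D89_I3 N4 N4' Dc hot Dhat x xc HHc c Hb H U Ub HcRX HcA gx gxc qZ qZ' Z3 _ Xh g₁₃ hDL
    rfl hcomm hZ hZ3 hZ3' hDx hDxc hcolH
  have h4 := D89_I4 N4' hot Dhat x xc xbc p hh HbHc DbHb DbxHb DbxdHb DbN4Hb Cm HbcN4Hb s2 e4xc exbc
    e4P eC r1 r2 r4 r5 Hb H Xi _ Xh A rfl hs2 hRic h4xc hn4xbc h4P hN4Db hCm hHbcN4 hDbN4 hLeib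
    hDbx hKc
  have h5 := D89_I5 N4 N4' hot x xc hh c Hb U Ub HcRX HcA g4 qZ UK Z3 _ Xh rfl hprodU h4Hb hZ hZ3
    hcolb hK
  have hsplit := D89_split N4' hot Dhat s2 Hb B U H2 A4 Xh hH2
  have hsum := D89_sum N4' hot Dhat x xc xbc p pc hh HHc HbHc DbHb s2 c Hb H B U Ub Xi A3 WA HcRX
    HcA H2 _ _ _ _ _ A4 A Xh MXi _ _ _ _ _ hH2 hs2 hsplit h1 h2 h3 h4 h5 hsB
  exact D89_final hot Dhat n3 x xc xb xbc p pc hh HbHc DbHb c Hb H B A3 gK2 _ H2 A Xh _ _ _ hsum hK2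
    hsB hBianchiA

/-! ## §4 The conclusion: `ᶜ∇₄ℌ + (7/2)tr X ℌ` and the coefficient of `(3/2)P·X̂` -/

/-- "We can finally conclude the derivation" (`[J]` p0923 L12 – p0924 L48 = `[v1]` l.37411–37446).
Entering: the splitting `ℌ = ℌ₁ + (3/2)Pℌ₂ + (3/2)P conj(tr X̲)A` (`hsplit`) and the background `ᶜ∇₄P`
(`h4P`, remainder `e4P`) — (D.8.3) is re-derived inside —; Lemma D.8.8 and Lemma D.8.9 in the shape of
the conclusions of `D88` and `D89` (`h88`: `M8` = the `Ξ`-part of the bracket of D.8.8, `E2 =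
Expr₂(A)`, bracket `R88`; `h89`: `MXt = 𝓜̃[Ξ]`, `E4 = Expr₄(A)`, bracket `R89`, the collapse factor `c`
inside); for the last step (l.37434–37438 = p0924 L10–26) "Using (2.4.2), i.e. `H̲⊗̂(H̄·X̂) + H⊗̂(H̲̄·X̂)
= (H̲·H̄ + H̲̄·H)X̂`" carried with the free factor `κ` (`hSL : … = κ(H̲·H̄ + H̲̄·H)X̂`; printed `κ = 1`,
(2.4.2) prints `2`), "and that `conj(tr X)H̲ = −tr X H + O(ε)`" (`hK2`, remainder `gK2`; paired with
`H̲̄` it gives `tr X H̲̄·H = −conj(tr X)H̲̄·H̲`, `hK6`, remainder `r6`), and the collapse `H̲⊗̂(H̲̄·X̂) =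
c(H̲·H̲̄)X̂` (`hcolb`).  Conclusion, valid in any gauge: `ᶜ∇₄ℌ + (7/2)tr X ℌ = (3/2)P·T(c, κ)·X̂ +
[Expr₂(A) + (3/2)P Expr₄(A) + ᶜ∇₄((3/2)P conj(tr X̲)A) + (21/4)P tr X conj(tr X̲)A] + (3/2)P(M8 +
𝓜̃[Ξ]) + (dropped products)`, where the text, in the gauge `Ξ = 0`, displays (l.37441–37446 = p0924
L27–48) "`ᶜ∇₄ℌ + (7/2)tr X ℌ = (3/2)P[(½(3tr X − 3conj tr X)conj(tr X tr X̲) + 3conj(tr X)conj𝒟·H̲ −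
3tr X(H̲·H̲̄) + 3(conj(tr X)P − tr X P̄))X̂] + Expr₂(A) + (3/2)P Expr₄(A) + ᶜ∇₄((3/2)P conj(tr X̲)A) +
(21/4)P tr X conj(tr X̲)A`"; `T(c, κ)` is spelled out in `TS_Xh_coefficient` and equals the printed
parenthesis iff its residual vanishes.
[cite: GiorgiKlainermanSzeftel2024, p0923 L12 – p0924 L48; GiorgiKlainermanSzeftel2022, l.37411–37446] -/
theorem TS_conclusion [CharZero K] {D4 : Derivation ℤ K K} (N4' : CovD D4 M₂)
    (hot : M₁ →ₗ[K] M₁ →ₗ[K] M₂)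
    (x xc xbc p pc hh HbHc HbcH DbHb c κ e4P r6 : K) (Hb H U Ub A3 gK2 : M₁)
    (Hh H1 H2 A Xh M8 MXt E2 E4 R88 R89 : M₂)
    (hsplit : Hh = H1 + (3 / 2 * p) • H2 + (3 / 2 * (p * xbc)) • A)
    (h4P : D4 p = -(3 / 2) * (x * p) + e4P)
    (h88 : N4'.op H1 + (7 / 2 * x) • H1
      = (3 / 2 * p) • (M8 + (3 * x) • hot Hb U + (3 * x) • hot Hb A3) + E2 + R88)
    (h89 : N4'.op H2 = -((2 * x) • H2) - (3 * x) • hot Hb A3 + MXt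
      + (1 / 2 * ((3 * x - 3 * xc) * (xc * xbc)) + 3 * xc * DbHb - (c + 2) * x * hh - 3 * x * HbHc
        + 3 * (xc * p - x * pc)) • Xh + E4 + R89)
    (hSL : hot Hb U + hot H Ub = (κ * (HbHc + HbcH)) • Xh)
    (hK2 : xc • Hb = -(x • H) + gK2) (hcolb : hot Hb Ub = (c * hh) • Xh)
    (hK6 : x * HbcH = -(xc * hh) + r6) :
    N4'.op Hh + (7 / 2 * x) • Hh
      = (3 / 2 * p) • ((1 / 2 * ((3 * x - 3 * xc) * (xc * xbc)) + 3 * xc * DbHb + 3 * (xc * p - x * pc)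
          - (c + 2) * x * hh - 3 * x * HbHc
          + 3 * c * (xc * hh) + 3 * κ * (x * HbHc) - 3 * κ * (xc * hh)) • Xh)
        + (E2 + (3 / 2 * p) • E4 + N4'.op ((3 / 2 * (p * xbc)) • A) + (21 / 4 * (x * (p * xbc))) • A)
        + (3 / 2 * p) • (M8 + MXt)
        + (R88 + (3 / 2 * p) • R89 + (3 / 2 * e4P) • H2
          + (3 / 2 * p) • ((3 * κ * r6) • Xh - (3 : K) • hot gK2 Ub)) := by
  obtain ⟨-, -, -, -, -, h32, -⟩ := Dm_num D4
  have hK2h := congrArg (fun v => hot v Ub) hK2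
  simp only [map_add, map_neg, map_smul, LinearMap.add_apply, LinearMap.neg_apply,
    LinearMap.smul_apply] at hK2h
  have hK6' : (x * HbcH) • Xh = (-(xc * hh) + r6) • Xh := by rw [hK6]
  subst hsplit
  rw [map_add, map_add, N4'.leibniz ((3 : K) / 2 * p), h89]
  simp only [D4.leibniz, h32, h4P, smul_eq_mul, mul_zero, add_zero]
  linear_combination (norm := module) h88 + ((9 / 2 : K) * (p * x)) • hSL
    - ((9 / 2 : K) * p) • hK2h + ((9 / 2 : K) * (p * xc)) • hcolb + ((9 / 2 : K) * (p * κ)) • hK6'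

/-- The coefficient `T(c, κ)` of `(3/2)P·X̂` in `TS_conclusion`, split as the PRINTED parenthesis `T₁ =
½(3tr X − 3conj tr X)conj(tr X tr X̲) + 3(conj(tr X)P − tr X P̄) + 3conj(tr X)conj𝒟·H̲ − 3tr X(H̲·H̲̄)`
(`[J]` p0924 L40–52 = `[v1]` l.37443–37444, l.37450) `+` the collapse-dependent residual `(1 − c)tr
X(H̲·H̲̄) + 3(c − κ)conj(tr X)(H̲·H̲̄) + 3(κ − 1)tr X(H̲·H̄)`, which vanishes identically iff `c = κ = 1`.
[cite: GiorgiKlainermanSzeftel2024, p0924 L40–52; GiorgiKlainermanSzeftel2022, l.37443–37450] -/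
theorem TS_Xh_coefficient (x xc xbc p pc hh HbHc DbHb c κ : K) :
    1 / 2 * ((3 * x - 3 * xc) * (xc * xbc)) + 3 * xc * DbHb + 3 * (xc * p - x * pc)
        - (c + 2) * x * hh - 3 * x * HbHc
        + 3 * c * (xc * hh) + 3 * κ * (x * HbHc) - 3 * κ * (xc * hh)
      = (1 / 2 * ((3 * x - 3 * xc) * (xc * xbc)) + 3 * (xc * p - x * pc) + 3 * xc * DbHb
          - 3 * x * hh)
        + ((1 - c) * (x * hh) + 3 * (c - κ) * (xc * hh) + 3 * (κ - 1) * (x * HbHc)) := by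
  ring


/-! ## §5 "We now show that the terms in the parenthesis vanish in Kerr" — REPRODUCED, and the
value of the residual `T(c, κ) − T(1, 1)` in Kerr -/

/-- The Kerr values of the pairings from the displayed components (`[J]` p0924 L53–60 = `[v1]`
l.37453–37457: "Recall that in Kerr … `H₁ = ai sin θ q/|q|³`, `H₂ = a sin θ q/|q|³`, `H̲₁ = −ai sin θ
q̄/|q|³`, `H̲₂ = −a sin θ q̄/|q|³`") and their conjugates, with `ξ·η = ξ₁η₁ + ξ₂η₂` (Definition 2.1.12),
`aS = a sin θ`, `w = 1/|q|³`, `ii = i`: `H̲·H̲̄ = 2a²sin²θ w²·qq̄` (= the displayed `H̲·H̲̄ = 2(a²/|q|⁶)(sin²θ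
r² + a²sin²θ cos²θ)`, l.37479 = p0925 L39–46, since `r² + a²cos²θ = |q|²`), `H̲·H̄ = −2a²sin²θ w²·q̄²`,
`H·H̄ = 2a²sin²θ w²·qq̄`, `H̲̄·H = −2a²sin²θ w²·q²`.  [folklore]
[cite: GiorgiKlainermanSzeftel2024, p0924 L53–60, p0925 L39–46; GiorgiKlainermanSzeftel2022, l.37453–37457, l.37477–37480] -/
theorem kerr_pairings (ii aS w q qb Hb1 Hb2 H1 H2 Hc1 Hc2 Hbc1 Hbc2 : K) (hii : ii * ii = -1)
    (hH1 : H1 = ii * aS * w * q) (hH2 : H2 = aS * w * q)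
    (hHb1 : Hb1 = -(ii * aS * w * qb)) (hHb2 : Hb2 = -(aS * w * qb))
    (hHc1 : Hc1 = -(ii * aS * w * qb)) (hHc2 : Hc2 = aS * w * qb)
    (hHbc1 : Hbc1 = ii * aS * w * q) (hHbc2 : Hbc2 = -(aS * w * q)) :
    Hb1 * Hbc1 + Hb2 * Hbc2 = 2 * aS ^ 2 * w ^ 2 * (q * qb) ∧
      Hb1 * Hc1 + Hb2 * Hc2 = -(2 * aS ^ 2 * w ^ 2 * qb ^ 2) ∧
      H1 * Hc1 + H2 * Hc2 = 2 * aS ^ 2 * w ^ 2 * (q * qb) ∧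
      Hbc1 * H1 + Hbc2 * H2 = -(2 * aS ^ 2 * w ^ 2 * q ^ 2) := by
  subst hH1 hH2 hHb1 hHb2 hHc1 hHc2 hHbc1 hHbc2
  refine ⟨?_, ?_, ?_, ?_⟩
  · linear_combination (-(aS ^ 2 * w ^ 2 * (q * qb))) * hii
  · linear_combination (aS ^ 2 * w ^ 2 * qb ^ 2) * hii
  · linear_combination (-(aS ^ 2 * w ^ 2 * (q * qb))) * hii
  · linear_combination (aS ^ 2 * w ^ 2 * q ^ 2) * hii

/-- "We now show that the terms in the parenthesis vanish in Kerr" — REPRODUCED (`[J]` p0924 L49 –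
p0925 L61 = `[v1]` l.37448–37486).  Hypotheses = the displayed Kerr values: "`tr X = 2/q`, `tr X̲ =
−2Δq/|q|⁴`, `P = −2m/q³`" (l.37455; conjugated: `conj tr X = 2/q̄`, `conj(tr X̲) = −2Δq̄/|q|⁴`, `P̄ =
−2m/q̄³`), "`conj𝒟·H̲ = 2div η̄ + 2i curl η̄ = 2(a²/|q|⁶)(−2cos²θ r² + sin²θ r² − a²sin²θ cos²θ −
2a²cos²θ) + i·2(a cos θ/|q|⁶)(−2r³ + 2a²cos²θ r − 4a²r)`" (l.37473–37475 = p0925 L25–38), "`H̲·H̲̄ =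
2(a²/|q|⁶)(sin²θ r² + a²sin²θ cos²θ)`" (l.37479), over a field with `q, q̄ ≠ 0`, `n = |q|² = qq̄`, `r =
(q + q̄)/2`, `A = a²cos²θ = −(q − q̄)²/4`, `S = a²sin²θ = a² − A`, `Δ = r² − 2mr + a²`, "`i·2a cos θ`"
= `q − q̄`.  Conclusions = every displayed intermediate value: `conj(tr X tr X̲) = −4Δ/|q|⁴`, `½(3tr X
− 3conj tr X)conj(tr X tr X̲) = i·24a cos θ Δ/|q|⁶`, `conj(tr X)P − tr X P̄ = 4m(q² − q̄²)/|q|⁶ = i·16a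
cos θ mr/|q|⁶` (l.37460–37463), their sum `i·24a cos θ(r² + a²)/|q|⁶ = i·(4a cos θ/|q|⁸)(6r⁴ +
6a²cos²θ r² + 6a²r² + 6a²a²cos²θ)` (l.37466–37469), `|q|² = r² + a²cos²θ`, `H̲·H̲̄ = 2a²sin²θ/|q|⁴`,
and the displayed total "`½(3tr X − 3conj tr X)conj(tr X tr X̲) + 3(conj(tr X)P − tr X P̄) + 3conj(tr
X)conj𝒟·H̲ − 3tr X(H̲·H̲̄) = … = 0`" (l.37481–37485 = p0925 L47–61).
[cite: GiorgiKlainermanSzeftel2024, p0924 L49 – p0925 L61; GiorgiKlainermanSzeftel2022, l.37448–37486] -/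
theorem kerr_T1_zero [CharZero K] (q qb a m r A S n Δ x xc xbc p pc DbHb hh : K)
    (hq : q ≠ 0) (hqb : qb ≠ 0)
    (hr : r = (q + qb) / 2) (hA : A = -((q - qb) ^ 2) / 4) (hS : S = a ^ 2 - A) (hn : n = q * qb)
    (hΔ : Δ = r ^ 2 - 2 * m * r + a ^ 2)
    (hx : x = 2 / q) (hxc : xc = 2 / qb) (hxbc : xbc = -(2 * Δ * qb) / n ^ 2)
    (hp : p = -(2 * m) / q ^ 3) (hpc : pc = -(2 * m) / qb ^ 3)
    (hdb : DbHb = 2 / n ^ 3 * (-(2 * A * r ^ 2) + S * r ^ 2 - S * A - 2 * a ^ 2 * A)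
      + (q - qb) / n ^ 3 * (-(2 * r ^ 3) + 2 * A * r - 4 * a ^ 2 * r))
    (hhh : hh = 2 / n ^ 3 * (S * r ^ 2 + S * A)) :
    xc * xbc = -(4 * Δ) / n ^ 2 ∧
      1 / 2 * ((3 * x - 3 * xc) * (xc * xbc)) = 12 * (q - qb) * Δ / n ^ 3 ∧
      xc * p - x * pc = 4 * m * (q ^ 2 - qb ^ 2) / n ^ 3 ∧
      4 * m * (q ^ 2 - qb ^ 2) / n ^ 3 = 8 * (q - qb) * m * r / n ^ 3 ∧
      1 / 2 * ((3 * x - 3 * xc) * (xc * xbc)) + 3 * (xc * p - x * pc)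
        = 2 * (q - qb) / n ^ 4 * (6 * r ^ 4 + 6 * A * r ^ 2 + 6 * a ^ 2 * r ^ 2 + 6 * a ^ 2 * A) ∧
      n = r ^ 2 + A ∧ hh = 2 * S / n ^ 2 ∧
      1 / 2 * ((3 * x - 3 * xc) * (xc * xbc)) + 3 * (xc * p - x * pc) + 3 * xc * DbHb - 3 * x * hh
        = 0 := by
  have hn0 : n ≠ 0 := by rw [hn]; exact mul_ne_zero hq hqb
  subst hx hxc hxbc hp hpc hdb hhh hS hΔ
  have hnA : n = r ^ 2 + A := by rw [hn, hr, hA]; ring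
  refine ⟨?_, ?_, ?_, ?_, ?_, hnA, ?_, ?_⟩
  · field_simp; ring
  · rw [hn]; field_simp; ring
  · rw [hn]; field_simp; ring
  · rw [hr]; field_simp; ring
  · rw [hn, hA, hr]; field_simp; ring
  · rw [hnA]; field_simp [show r ^ 2 + A ≠ 0 from hnA ▸ hn0]
  · rw [hn, hA, hr]; field_simp; ring

/-- The collapse-dependent residual of `TS_Xh_coefficient` on the same Kerr values (`tr X = 2/q`, `conj
tr X = 2/q̄`, `H̲·H̲̄ = 2a²sin²θ/|q|⁴`, and `H̲·H̄ = −2a²sin²θ q̄²/|q|⁶` from `kerr_pairings`; `S =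
a²sin²θ`, `n = |q|² = qq̄`): `(1 − c)tr X(H̲·H̲̄) + 3(c − κ)conj(tr X)(H̲·H̲̄) + 3(κ − 1)tr X(H̲·H̄) =
(4a²sin²θ/(q³q̄³))·((1 − c)q̄ + 3(c − κ)q − 3(κ − 1)q̄²/q)` — zero for all `q` iff `c = κ = 1` —, and
at the factors `c = κ = 2` of `[J]` (2.4.2)/(2.4.3) (`simil_leibniz_components`) the value
`−4a²sin²θ(q + 3q̄)/(q⁴q̄²)`.  This is the kernel half of PRINT DATUM (PD-c) (module docstring): with
the inputs of App. D.8 as printed, the coefficient of `(3/2)P·X̂` in `ᶜ∇₄ℌ + (7/2)tr X ℌ` vanishes in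
Kerr for the printed collapse factor 1 (`kerr_T1_zero`) and equals `−4a²sin²θ(q + 3q̄)/(q⁴q̄²)` for the
factor 2.  [folklore]
[cite: GiorgiKlainermanSzeftel2024, p0924 L10–52, p0111 L35–44; GiorgiKlainermanSzeftel2022, l.37434–37450, l.4928–4937] -/
theorem kerr_T_residual [CharZero K] (q qb S n x xc hh HbHc c κ : K) (hq : q ≠ 0) (hqb : qb ≠ 0)
    (hn : n = q * qb) (hx : x = 2 / q) (hxc : xc = 2 / qb)
    (hhh : hh = 2 * S / n ^ 2) (hHbHc : HbHc = -(2 * S * qb ^ 2) / n ^ 3) :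
    (1 - c) * (x * hh) + 3 * (c - κ) * (xc * hh) + 3 * (κ - 1) * (x * HbHc)
        = 4 * S / (q ^ 3 * qb ^ 3) * ((1 - c) * qb + 3 * (c - κ) * q - 3 * (κ - 1) * (qb ^ 2 / q)) ∧
      ((1 - 2) * (x * hh) + 3 * (2 - 2) * (xc * hh) + 3 * (2 - 1) * (x * HbHc)
        = -(4 * S * (q + 3 * qb)) / (q ^ 4 * qb ^ 2)) := by
  subst hn hx hxc hhh hHbHc
  constructor
  · field_simp; ring
  · field_simp; ring


/-! ## §6 "Finally we show that `ᶜ∇₄ℌ + (7/2)tr X ℌ = (ᶜ∇₄ + 2tr X)⁴A̲`" — the `q`-weights -/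

/-- Powers of the weight `q` under `ᶜ∇₄` when `ᶜ∇₄q = 1`. [folklore] -/
theorem D4_qpow {D4 : Derivation ℤ K K} (q : K) (hDq : D4 q = 1) :
    D4 (q ^ 2) = 2 * q ∧ D4 (q ^ 3) = 3 * q ^ 2 ∧ D4 (q ^ 4) = 4 * q ^ 3 ∧ D4 (q ^ 5) = 5 * q ^ 4 ∧
      D4 (q ^ 6) = 6 * q ^ 5 ∧ D4 (q ^ 7) = 7 * q ^ 6 := by
  have h2 : D4 (q ^ 2) = 2 * q := by
    rw [show q ^ 2 = q * q by ring, D4.leibniz, hDq, smul_eq_mul]; ring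
  have h3 : D4 (q ^ 3) = 3 * q ^ 2 := by
    rw [show q ^ 3 = q ^ 2 * q by ring, D4.leibniz, hDq, h2, smul_eq_mul, smul_eq_mul]; ring
  have h4 : D4 (q ^ 4) = 4 * q ^ 3 := by
    rw [show q ^ 4 = q ^ 3 * q by ring, D4.leibniz, hDq, h3, smul_eq_mul, smul_eq_mul]; ring
  have h5 : D4 (q ^ 5) = 5 * q ^ 4 := by
    rw [show q ^ 5 = q ^ 4 * q by ring, D4.leibniz, hDq, h4, smul_eq_mul, smul_eq_mul]; ring
  have h6 : D4 (q ^ 6) = 6 * q ^ 5 := by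
    rw [show q ^ 6 = q ^ 5 * q by ring, D4.leibniz, hDq, h5, smul_eq_mul, smul_eq_mul]; ring
  have h7 : D4 (q ^ 7) = 7 * q ^ 6 := by
    rw [show q ^ 7 = q ^ 6 * q by ring, D4.leibniz, hDq, h6, smul_eq_mul, smul_eq_mul]; ring
  exact ⟨h2, h3, h4, h5, h6, h7⟩

/-- "Finally we show that `ᶜ∇₄ℌ + (7/2)tr X ℌ = (ᶜ∇₄ + 2tr X)⁴A̲`" — the weights (`[J]` p0926 L52–110
= `[v1]` l.37510–37528): "Recall that `𝔉 = −ᶜ∇₄A̲ − ½tr X A̲`, `𝔊 = ᶜ∇₄𝔉 + (3/2)tr X 𝔉`, `ℌ = ᶜ∇₄𝔊 +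
(5/2)tr X 𝔊` … Choosing a normalization such that `ω = O(ε)`, and hence `tr X = 2/q + O(ε)`, we
obtain `𝔉 = −(1/q)ᶜ∇₄(qA̲)`, `𝔊 = (1/q³)∇₄(q³𝔉)`, `ℌ = (1/q⁵)∇₄(q⁵𝔊)`, `∇₄ℌ + (7/2)tr X ℌ =
(1/q⁷)∇₄(q⁷ℌ)`.  We infer `(1/q⁷)∇₄(q²∇₄(q²∇₄(q²ᶜ∇₄(qA̲)))) = 𝒫(A)`."  Over any `K`-module with a
`CovD` (one operator `ᶜ∇₄ = ∇₄` on `𝔰₂(ℂ)`), with `ᶜ∇₄q = 1` and `tr X·q = 2` entered exactly (`hDq`,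
`hxq`) and in weight-multiplied (division-free) form: `q𝔉 = −ᶜ∇₄(qA̲)`, `q³𝔊 = ∇₄(q³𝔉)`, `q⁵ℌ =
∇₄(q⁵𝔊)`, `q⁷(∇₄ℌ + (7/2)tr X ℌ) = ∇₄(q⁷ℌ)`, and the composite WITH ITS SIGN: `q⁷(∇₄ℌ + (7/2)tr X ℌ) =
−∇₄(q²∇₄(q²∇₄(q²ᶜ∇₄(qA̲))))` — the print (l.37527 = p0926 L98–110) omits the minus inherited from `𝔉 =
−(1/q)ᶜ∇₄(qA̲)`; immaterial for the schematic (5.4.1).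
[cite: GiorgiKlainermanSzeftel2024, p0926 L52–110; GiorgiKlainermanSzeftel2022, l.37510–37528] -/
theorem qweights [CharZero K] {M : Type*} [AddCommGroup M] [Module K M] {D4 : Derivation ℤ K K}
    (N : CovD D4 M) (q x : K) (Ab Ff Gg Hh : M) (hDq : D4 q = 1) (hxq : x * q = 2)
    (hF : Ff = -(N.op Ab) - (1 / 2 * x) • Ab) (hG : Gg = N.op Ff + (3 / 2 * x) • Ff)
    (hH : Hh = N.op Gg + (5 / 2 * x) • Gg) :
    q • Ff = -(N.op (q • Ab)) ∧ q ^ 3 • Gg = N.op (q ^ 3 • Ff) ∧ q ^ 5 • Hh = N.op (q ^ 5 • Gg) ∧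
      q ^ 7 • (N.op Hh + (7 / 2 * x) • Hh) = N.op (q ^ 7 • Hh) ∧
      q ^ 7 • (N.op Hh + (7 / 2 * x) • Hh)
        = -(N.op (q ^ 2 • N.op (q ^ 2 • N.op (q ^ 2 • N.op (q • Ab))))) := by
  obtain ⟨-, h3, -, h5, -, h7⟩ := D4_qpow q hDq
  have e1 : q • Ff = -(N.op (q • Ab)) := by
    rw [hF, N.leibniz, hDq]
    linear_combination (norm := module) (-(1 / 2 : K) * hxq) • Ab
  have e2 : q ^ 3 • Gg = N.op (q ^ 3 • Ff) := by
    rw [hG, N.leibniz, h3]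
    linear_combination (norm := module) ((3 / 2 : K) * q ^ 2 * hxq) • Ff
  have e3 : q ^ 5 • Hh = N.op (q ^ 5 • Gg) := by
    rw [hH, N.leibniz, h5]
    linear_combination (norm := module) ((5 / 2 : K) * q ^ 4 * hxq) • Gg
  have e4 : q ^ 7 • (N.op Hh + (7 / 2 * x) • Hh) = N.op (q ^ 7 • Hh) := by
    rw [N.leibniz, h7]
    linear_combination (norm := module) ((7 / 2 : K) * q ^ 6 * hxq) • Hh
  refine ⟨e1, e2, e3, e4, ?_⟩
  rw [e4, show q ^ 7 • Hh = q ^ 2 • (q ^ 5 • Hh) by rw [smul_smul]; ring_nf, e3,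
    show q ^ 5 • Gg = q ^ 2 • (q ^ 3 • Gg) by rw [smul_smul]; ring_nf, e2,
    show q ^ 3 • Ff = q ^ 2 • (q • Ff) by rw [smul_smul]; ring_nf, e1, smul_neg, map_neg, smul_neg,
    map_neg, smul_neg, map_neg]

/-- The expansion (`[J]` p0927 L1–60 = `[v1]` l.37529–37545): "The above can be written as
`(1/q³)∇₄(q²∇₄)³(qA̲) = … = q⁴∇₄⁴A̲ + 16q³∇₄³A̲ + 72q²∇₄²A̲ + 96q∇₄A̲ + 24A̲`, which is equivalent to
`(1/q⁴)ᶜ∇₄⁴(q⁴A̲) = q⁴∇₄⁴A̲ + 4∇₄(q⁴)∇₄³A̲ + 6∇₄²(q⁴)∇₄²A̲ + 4∇₄³(q⁴)∇₄A̲ + ∇₄⁴(q⁴)A̲ = q⁴∇₄⁴A̲ +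
16q³∇₄³A̲ + 72q²∇₄²A̲ + 96q∇₄A̲ + 24A̲`, which can be written as `(∇₄ + 2tr X)⁴A̲ = 𝒫(A)`."  With `ᶜ∇₄q =
1`, `tr X·q = 2` (`hDq`, `hxq`) and `S = ∇₄ + 2tr X` (`hS`), in weight-multiplied form: `∇₄(q²∇₄(q²∇₄(q²
∇₄(qA̲)))) = q³·(q⁴∇₄⁴A̲ + 16q³∇₄³A̲ + 72q²∇₄²A̲ + 96q∇₄A̲ + 24A̲)` (so the printed prefactor is `1/q³`
throughout, not the `1/q², 1/q³` of l.37531–37533, and there is no `1/q⁴` on the left of l.37538),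
`∇₄⁴(q⁴A̲) =` the same bracket, and `q⁴(∇₄ + 2tr X)⁴A̲ = ∇₄⁴(q⁴A̲)`.
[cite: GiorgiKlainermanSzeftel2024, p0927 L1–60; GiorgiKlainermanSzeftel2022, l.37529–37545] -/
theorem qweights_expand [CharZero K] {M : Type*} [AddCommGroup M] [Module K M]
    {D4 : Derivation ℤ K K} (N : CovD D4 M) (S : M → M) (q x : K) (Ab : M) (hDq : D4 q = 1)
    (hxq : x * q = 2) (hS : ∀ v, S v = N.op v + (2 * x) • v) :
    N.op (q ^ 2 • N.op (q ^ 2 • N.op (q ^ 2 • N.op (q • Ab))))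
        = q ^ 3 • (q ^ 4 • N.op (N.op (N.op (N.op Ab))) + (16 * q ^ 3) • N.op (N.op (N.op Ab))
          + (72 * q ^ 2) • N.op (N.op Ab) + (96 * q) • N.op Ab + (24 : K) • Ab) ∧
      N.op (N.op (N.op (N.op (q ^ 4 • Ab))))
        = q ^ 4 • N.op (N.op (N.op (N.op Ab))) + (16 * q ^ 3) • N.op (N.op (N.op Ab))
          + (72 * q ^ 2) • N.op (N.op Ab) + (96 * q) • N.op Ab + (24 : K) • Ab ∧
      q ^ 4 • S (S (S (S Ab))) = N.op (N.op (N.op (N.op (q ^ 4 • Ab)))) := by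
  obtain ⟨d2, d3, d4, -, -, -, -⟩ := Dm_num D4
  obtain ⟨h2, h3, h4, -, -, -⟩ := D4_qpow q hDq
  have hstep : ∀ v, q ^ 4 • S v = N.op (q ^ 4 • v) := by
    intro v
    rw [hS, N.leibniz, h4]
    linear_combination (norm := module) ((2 : K) * q ^ 3 * hxq) • v
  refine ⟨?_, ?_, ?_⟩
  · simp only [N.leibniz, map_add, D4.leibniz, hDq, h2, d2, smul_eq_mul, mul_one, mul_zero,
      add_zero, one_smul, smul_add]
    module
  · simp only [N.leibniz, map_add, D4.leibniz, hDq, h2, h3, h4, d2, d3, d4, smul_eq_mul, mul_zero,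
      add_zero, mul_one]
    module
  · rw [hstep, hstep, hstep, hstep]

/-! ## §0bis The collapse factor from the component definitions — `[J]` Lemma 2.4.5 in components -/

/-- The collapse factor from the definitions: `[J]` Lemma 2.4.5, (2.4.2) "`E⊗̂(F̄·U) + F⊗̂(Ē·U) = 2(E·F̄ +
Ē·F)U`" and (2.4.3) "`E⊗̂(F̄·U) = 4(e·f − ie∧f)U`" (file p0111 L35–44, proof p0111 L46 – p0112 L12 =
`[v1]` l.4928–4967), in components, from Definition 2.1.12 (file p0069 L10–24 = `[v1]` l.2755–2770:
`ξ·η = δ^{ab}ξ_aη_b`, `(ξ⊗̂η)_{ab} = ξ_aη_b + ξ_bη_a − δ_{ab}ξ·η`, `(ξ·U)_a = δ^{bc}ξ_bU_{ac}`) extended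
bilinearly WITHOUT conjugation, as the text does: for `E ∈ 𝔰₁(ℂ)` (`E = e + i⋆e`, i.e. `E₂ = −iE₁`),
`G = F̄` with `F ∈ 𝔰₁(ℂ)` (`G₂ = iG₁`) and `U ∈ 𝔰₂(ℂ)` (`U = u + i⋆u` symmetric traceless, i.e. `U₁₂ =
−iU₁₁`, `U₂₂ = −U₁₁`), with `V := G·U`: `(E⊗̂V)₁₁ = 2(E·G)U₁₁`, `(E⊗̂V)₁₂ = 2(E·G)U₁₂`, `(E⊗̂V)₂₂ =
2(E·G)U₂₂` — i.e. `E⊗̂(F̄·U) = 2(E·F̄)U`, each of the two terms of (2.4.2) separately carrying the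
factor 2 (consistent with (2.4.3): `E·F̄ = 2(e·f − ie∧f)`) — together with `E·G = 2E₁G₁`, `V₁ =
2U₁₁G₁`.  Hence the collapses `H̲⊗̂(H̲̄·X̂) = c(H̲·H̲̄)X̂`, `H⊗̂(H̄·X̂) = c(H·H̄)X̂` and the sum form
`H̲⊗̂(H̄·X̂) + H⊗̂(H̲̄·X̂) = κ(H̲·H̄ + H̲̄·H)X̂` hold with `c = κ = 2` under the book's definitions, where
App. D.8 writes them with `c = κ = 1` (`[v1]` l.36718–36777, 37307–37310, 37359–37363, 37434–37438).
[folklore]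
[cite: GiorgiKlainermanSzeftel2024, p0069 L10–24, p0111 L35 – p0112 L12, p0924 L10–26; GiorgiKlainermanSzeftel2022, l.2755–2770, l.4928–4967, l.37434–37438] -/
theorem simil_leibniz_components (ii E1 E2 G1 G2 U11 U12 U22 : K) (hii : ii * ii = -1)
    (hE : E2 = -(ii * E1)) (hG : G2 = ii * G1) (hU12 : U12 = -(ii * U11)) (hU22 : U22 = -U11) :
    -- `V := U·G` (`V_a = U_{ab} G_b`), `E·G = E₁G₁ + E₂G₂`, `(E⊗̂V)_{ab} = E_aV_b + E_bV_a − δ_{ab} E·V`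
    let V1 := U11 * G1 + U12 * G2
    let V2 := U12 * G1 + U22 * G2
    let EG := E1 * G1 + E2 * G2
    let EV := E1 * V1 + E2 * V2
    (2 * (E1 * V1) - EV = 2 * EG * U11) ∧ (E1 * V2 + E2 * V1 = 2 * EG * U12) ∧
      (2 * (E2 * V2) - EV = 2 * EG * U22) ∧ EG = 2 * (E1 * G1) ∧ V1 = 2 * (U11 * G1) := by
  subst hE hG hU12 hU22
  refine ⟨?_, ?_, ?_, ?_, ?_⟩
  · linear_combination (-(E1 * U11 * G1)) * hii
  · linear_combination (-(ii * E1 * U11 * G1)) * hii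
  · linear_combination (E1 * U11 * G1) * hii
  · linear_combination (-(E1 * G1)) * hii
  · linear_combination (-(U11 * G1)) * hii

end Literature.Geometry.Lorentzian.GiorgiKlainermanSzeftel2022.TeukolskyStarobinskiDerivLedger
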